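import Literature.Probability.LatticeModels.DiscreteRectStokesBound
import Mathlib.Algebra.Order.Interval.Finset.SuccPred
import Mathlib.Topology.Order.Compact
import Mathlib.Topology.UnitInterval
import HarnessLib

/-!
# Self-duality of discrete extremal lengths: the discrete harmonic conjugate and the lower bound
# `ℓ_Ω̄[(a_ext b_ext),(c_ext d_ext)] · ℓ_Ω̄[(b_ext c_ext),(d_ext a_ext)] ≥ 1/96`

Discharge of the named fact `Literature.Probability.LatticeModels.discreteEL_ext_selfDual`
(Chelkak–Duminil-Copin–Hongler 2016, §3.3, third displayed property: self-duality of the discrete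
extremal lengths of the completed graph `Ω̄` of a topological rectangle, up to an absolute constant):
`discreteEL_ext_selfDual_holds`, with `C = 5476`. The upper half
`ℓ_Ω̄[A,C] · ℓ_Ω̄[B,D] ≤ 5476` is `IsRect.extResistance_mul_extResistance_le`
(`DiscreteRectStokesBound`); this file proves the lower half
`ℓ_Ω̄[A,C] · ℓ_Ω̄[B,D] ≥ 1/96` (`IsRect.le_extResistance_mul_extResistance`).

The printed source obtains both halves from the comparison of discrete and continuous extremal
lengths (Chelkak 2016, Prop. 6.2 and Cor. 6.3: conformal map of the polygonal representation onto a
rectangle, where the two continuous extremal lengths are exact inverses). Mathlib has no conformal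
mapping of polygons, so the road taken here is the purely discrete form of the classical
conjugate-function argument (Chelkak 2016, Remark 6.5: "one can pass from `V` to its harmonic
conjugate function `V*` …"; Duffin 1956): for a rectangle `IsRect E d₀ n` with completed graph `Ω̄`,

1. the energy minimiser `u` for `(A_ext, C_ext)` exists and is harmonic off `A_ext ∪ C_ext`
   (compactness on `[0,1]^W` and a first-variation argument), and its energy is the current `I`
   flowing out of `A_ext` (discrete Green formula), so that `𝒞(A ↔ C) = I`;
2. **plane winding potentials**: an antisymmetric, finitely supported, divergence-free function on
   the arrows of `ℤ²` has a potential on the unit squares (`exists_wind`: column sums);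
3. the current of `u`, completed along the boundary cycle by the cumulative pendant currents, is
   such a function (`zeta`, `IsRect.sum_zeta_eq_zero`); its winding potential vanishes on the
   exterior square of every dart of the boundary cycle (propagation along the contour from the
   leftmost column, `IsRect.exists_conjugate`), which yields values on the faces AND on the
   boundary positions of the rectangle whose jumps across arrows and darts are the currents
   (the harmonic conjugate read at the corners of the vertices, `IsRect.phi`,
   `IsRect.phi_sub_phi_of_mem`, `IsRect.phi_sub_phi_of_not_mem`, `IsRect.phi_add_dir`);
4. the conjugate at the `0`-th corner of each vertex is a test function `w` for `(B_ext, D_ext)`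
   with `ℰ(w) ≤ 96 ℰ(u) = 96 I` (`IsRect.dirE_wfun_le`: going round a vertex costs at most the
   total flux through it) and boundary values `-I` on `B_ext`, `0` on `D_ext`; hence
   `𝒞(B ↔ D) ≤ 96 / I` and `ℓ_Ω̄[A,C] · ℓ_Ω̄[B,D] = 𝒞(B ↔ D)⁻¹ · I⁻¹ ≥ 1/96`.

Everything is proved; no named fact is introduced (net debt `-1`).

## References
* D. Chelkak, H. Duminil-Copin, C. Hongler, EJP 21 (2016) no. 5, §3.3. [ChelkakDuminilCopinHongler2016]
* D. Chelkak, *Robust discrete complex analysis: a toolbox*, Ann. Probab. 44 (2016), §6, Prop. 6.4,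
  Remark 6.5. [Chelkak2016]
* R. J. Duffin, *Basic properties of discrete analytic functions*, Duke Math. J. 23 (1956) (discrete
  harmonic conjugates).
-/

noncomputable section

open scoped ENNReal NNReal
open Finset

namespace Literature.Probability.LatticeModels

namespace DiscreteRect

/-! ### Points of `ℤ²` in coordinates -/

section Points

/-- Coordinates of the direction vectors. [folklore] -/
@[simp] theorem dir_apply (k : Fin 4) :
    (dir k) 0 = ![1, 0, -1, 0] k ∧ (dir k) 1 = ![0, 1, 0, -1] k := by
  fin_cases k <;> simp [dir]

/-- `(a, b) + e_k` in coordinates. [folklore] -/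
theorem vec2_add_dir (a b : ℤ) (k : Fin 4) :
    (![a, b] : Site 2) + dir k = ![a + ![1, 0, -1, 0] k, b + ![0, 1, 0, -1] k] := by
  rw [Site.eq_iff_two]
  simp [Pi.add_apply, (dir_apply k).1, (dir_apply k).2]

end Points

/-! ### Plane winding potentials of divergence-free arrow functions -/

section Wind

/-- **The winding potential** of an arrow function `z`, by column sums: the value at the unit
square `s` (lower-left corner) is the sum of `z` over the East arrows `(s₀, j) → (s₀ + 1, j)`,
`B ≤ j ≤ s₁`, i.e. the flux of `z` through the vertical dual ray from far below up to `s`.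
[folklore] -/
def wind (B : ℤ) (z : Site 2 × Fin 4 → ℝ) (s : Site 2) : ℝ :=
  ∑ j ∈ Icc B (s 1), z (![s 0, j], 0)

variable {z : Site 2 × Fin 4 → ℝ} {B L : ℤ}

/-- Telescoping over an integer interval. [folklore] -/
theorem sum_Icc_sub_telescope (g : ℤ → ℝ) (B k : ℤ) (h : B ≤ k + 1) :
    ∑ j ∈ Icc B k, (g (j - 1) - g j) = g (B - 1) - g k := by
  obtain ⟨n, rfl⟩ : ∃ n : ℕ, k = B - 1 + n := ⟨(k + 1 - B).toNat, by omega⟩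
  induction n with
  | zero => simp
  | succ n ih =>
    rw [Nat.cast_succ, ← add_assoc, ← insert_Icc_right_eq_Icc_add_one (by omega),
      sum_insert (by simp), ih (by omega)]
    ring

/-- One step down: `wind s - wind (s - e₁)` is the East arrow at `s` (or nothing below row `B`).
[folklore] -/
theorem wind_sub_wind_add_dir_three (hB : ∀ a, z a ≠ 0 → B ≤ a.1 1) (s : Site 2) :
    wind B z s - wind B z (s + dir 3) = z (s, 0) := by
  unfold wind
  have h0 : (s + dir 3) 0 = s 0 := by simp [Pi.add_apply]
  have h1 : (s + dir 3) 1 = s 1 - 1 := by simp [Pi.add_apply, sub_eq_add_neg]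
  have hs' : (![s 0, s 1] : Site 2) = s := by rw [Site.eq_iff_two]; simp
  rw [h0, h1]
  by_cases hs : B ≤ s 1
  · conv_lhs => rw [show s 1 = s 1 - 1 + 1 by ring,
      ← insert_Icc_right_eq_Icc_add_one (by omega), sum_insert (by simp)]
    rw [show s 1 - 1 + 1 = s 1 by ring, hs']
    ring
  · rw [Icc_eq_empty (by omega), Icc_eq_empty (by omega), sum_empty, sub_zero]
    by_contra h
    exact hs (hB (s, 0) (Ne.symm h))

/-- One step left: `wind (s - e₀) - wind s` is the North arrow at `s` (divergence-freeness,
telescoped down the column). [folklore] -/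
theorem wind_add_dir_two_sub_wind (hanti : ∀ a, z (rev a) = -z a)
    (hdiv : ∀ p, ∑ m : Fin 4, z (p, m) = 0) (hB : ∀ a, z a ≠ 0 → B ≤ a.1 1) (s : Site 2) :
    wind B z (s + dir 2) - wind B z s = z (s, 1) := by
  unfold wind
  have h0 : (s + dir 2) 0 = s 0 - 1 := by simp [Pi.add_apply, sub_eq_add_neg]
  have h1 : (s + dir 2) 1 = s 1 := by simp [Pi.add_apply]
  have hs' : (![s 0, s 1] : Site 2) = s := by rw [Site.eq_iff_two]; simp
  rw [h0, h1, ← neg_sub, ← sum_sub_distrib]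
  -- the summand telescopes in `j`
  have hterm : ∀ j, z (![s 0, j], 0) - z (![s 0 - 1, j], 0) =
      z (![s 0, j - 1], 1) - z (![s 0, j], 1) := by
    intro j
    have hd := hdiv ![s 0, j]
    rw [Fin.sum_univ_four] at hd
    have h2 : z (![s 0, j], 2) = -z (![s 0 - 1, j], 0) := by
      rw [← hanti]
      congr 1
      rw [rev_mk, vec2_add_dir]
      simp
    have h3 : z (![s 0, j], 3) = -z (![s 0, j - 1], 1) := by
      rw [← hanti]
      congr 1
      rw [rev_mk, vec2_add_dir]
      simp
    linarith
  simp_rw [hterm]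
  by_cases hs : B ≤ s 1
  · rw [sum_Icc_sub_telescope (fun j ↦ z (![s 0, j], 1)) B (s 1) (by omega)]
    have hb : z (![s 0, B - 1], 1) = 0 := by
      by_contra h
      have := hB _ h
      simp at this
    rw [hb, zero_sub, neg_neg, hs']
  · rw [Icc_eq_empty (by omega), sum_empty, neg_zero]
    by_contra h
    exact hs (hB (s, 1) (Ne.symm h))

/-- The potential relation passes to reversed arrows. [folklore] -/
theorem wind_rel_rev (hanti : ∀ a, z (rev a) = -z a) (κ : Site 2 → ℝ) {a : Site 2 × Fin 4}
    (h : κ (lsq a) - κ (rsq a) = z a) : κ (lsq (rev a)) - κ (rsq (rev a)) = z (rev a) := by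
  rw [lsq_rev, rsq_rev, hanti, ← h]
  ring

/-- **Existence of the plane winding potential.** An antisymmetric arrow function on `ℤ²` with
zero divergence at every vertex, vanishing on arrows starting below row `B`, has a potential on the
unit squares — `κ (left square) - κ (right square) = z` across every arrow — which vanishes on all
squares to the left of any column `L` left of the support. (Column sums; the horizontal relation is
the divergence theorem for a column.) [folklore] -/
theorem exists_wind (z : Site 2 × Fin 4 → ℝ) (B L : ℤ) (hanti : ∀ a, z (rev a) = -z a)
    (hdiv : ∀ p, ∑ m : Fin 4, z (p, m) = 0)
    (hsupp : ∀ a, z a ≠ 0 → B ≤ a.1 1 ∧ L ≤ a.1 0) :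
    ∃ κ : Site 2 → ℝ, (∀ a, κ (lsq a) - κ (rsq a) = z a) ∧ ∀ s : Site 2, s 0 < L → κ s = 0 := by
  have hB : ∀ a, z a ≠ 0 → B ≤ a.1 1 := fun a h ↦ (hsupp a h).1
  refine ⟨wind B z, fun a ↦ ?_, fun s hs ↦ ?_⟩
  · obtain ⟨p, m⟩ := a
    have key0 : ∀ p, wind B z (lsq (p, 0)) - wind B z (rsq (p, 0)) = z (p, 0) := fun p ↦ by
      rw [lsq_mk, rsq_mk]
      simp only [quad, Fin.isValue, Matrix.cons_val_zero, zero_add, Matrix.cons_val]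
      exact wind_sub_wind_add_dir_three hB p
    have key1 : ∀ p, wind B z (lsq (p, 1)) - wind B z (rsq (p, 1)) = z (p, 1) := fun p ↦ by
      rw [lsq_mk, rsq_mk]
      simp only [quad, Fin.isValue, Matrix.cons_val_one, Matrix.cons_val_zero,
        show (1 : Fin 4) + 3 = 0 by decide]
      exact wind_add_dir_two_sub_wind hanti hdiv hB p
    fin_cases m
    · exact key0 p
    · exact key1 p
    · have h := wind_rel_rev hanti (wind B z) (key0 (p + dir 2))
      have e : rev (p + dir 2, 0) = (p, 2) := by
        rw [rev_mk, add_assoc, show dir 2 + dir 0 = (0 : Site 2) by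
          rw [add_comm]; exact (dir_add_dir_eq_zero_iff 0 2).2 rfl, add_zero]
        rfl
      rwa [e] at h
    · have h := wind_rel_rev hanti (wind B z) (key1 (p + dir 3))
      have e : rev (p + dir 3, 1) = (p, 3) := by
        rw [rev_mk, add_assoc, show dir 3 + dir 1 = (0 : Site 2) by
          rw [add_comm]; exact (dir_add_dir_eq_zero_iff 1 3).2 rfl, add_zero]
        rfl
      rwa [e] at h
  · unfold wind
    refine sum_eq_zero fun j _ ↦ ?_
    by_contra h
    have := (hsupp _ h).2
    simp at this
    omega

end Wind

/-! ### The Dirichlet energy along a rectangle as a real function; clamping; locality -/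

section RealEnergy

variable {E : Finset (Sym2 (Site 2))} {d₀ : Site 2 × Fin 4} {n : Fin 4 → ℕ}

/-- **The real Dirichlet energy of a potential on `Ω̄` along the rectangle `(E, d₀, n)`**: squared
increments over the edges of `E` plus those over the pendant edges of one period of the boundary
cycle (`= networkEnergy (extGraph E) 1 u` for a rectangle, `IsRect.networkEnergy_eq`). [folklore] -/
def dirE (E : Finset (Sym2 (Site 2))) (d₀ : Site 2 × Fin 4) (n : Fin 4 → ℕ)
    (u : Site 2 ⊕ (Site 2 × Fin 4) → ℝ) : ℝ :=
  ∑ e ∈ E, sqIncr (u ∘ Sum.inl) e + ∑ i ∈ range (n 0 + n 1 + n 2 + n 3), dP u ((succ E)^[i] d₀) ^ 2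

/-- The real energy is nonnegative. [folklore] -/
theorem dirE_nonneg (u : Site 2 ⊕ (Site 2 × Fin 4) → ℝ) : 0 ≤ dirE E d₀ n u :=
  add_nonneg (sum_nonneg fun _ _ ↦ sqIncr_nonneg _ _) (sum_nonneg fun _ _ ↦ sq_nonneg _)

/-- The real energy is the Dirichlet energy of `Ω̄`. [folklore] -/
theorem IsRect.networkEnergy_eq_dirE (hR : IsRect E d₀ n) (u : Site 2 ⊕ (Site 2 × Fin 4) → ℝ) :
    networkEnergy (extGraph E) 1 u = ENNReal.ofReal (dirE E d₀ n u) :=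
  hR.networkEnergy_eq u

/-- **The vertices of `Ω̄`** along the rectangle: lattice vertices of `E` and the external vertices
of one period of the boundary cycle. [folklore] -/
def extVerts (E : Finset (Sym2 (Site 2))) (d₀ : Site 2 × Fin 4) (n : Fin 4 → ℕ) :
    Finset (Site 2 ⊕ (Site 2 × Fin 4)) :=
  (verts E).image Sum.inl ∪ (range (n 0 + n 1 + n 2 + n 3)).image fun i ↦ Sum.inr ((succ E)^[i] d₀)

/-- Lattice vertices of `E` are vertices of `Ω̄`. [folklore] -/
theorem inl_mem_extVerts {x : Site 2} (hx : x ∈ verts E) : Sum.inl x ∈ extVerts E d₀ n :=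
  mem_union_left _ (mem_image_of_mem _ hx)

/-- The external vertices of the cycle are vertices of `Ω̄`. [folklore] -/
theorem inr_mem_extVerts {i : ℕ} (hi : i < n 0 + n 1 + n 2 + n 3) :
    Sum.inr ((succ E)^[i] d₀) ∈ extVerts E d₀ n :=
  mem_union_right _ (mem_image_of_mem _ (mem_range.2 hi))

/-- **Locality**: the real energy only depends on the values at the vertices of `Ω̄`. [folklore] -/
theorem IsRect.dirE_congr (hR : IsRect E d₀ n) {u₁ u₂ : Site 2 ⊕ (Site 2 × Fin 4) → ℝ}
    (h : ∀ v ∈ extVerts E d₀ n, u₁ v = u₂ v) : dirE E d₀ n u₁ = dirE E d₀ n u₂ := by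
  unfold dirE
  congr 1
  · refine sum_congr rfl fun e he ↦ ?_
    induction e using Sym2.ind with
    | h x y =>
      simp only [sqIncr_mk, Function.comp_apply]
      rw [h _ (inl_mem_extVerts (mem_verts_of_mem (by rw [Sym2.eq_swap]; exact he))),
        h _ (inl_mem_extVerts (mem_verts_of_mem he))]
  · refine sum_congr rfl fun i hi ↦ ?_
    simp only [dP]
    rw [h _ (inl_mem_extVerts (hR.isExtDart_iterate i).1), h _ (inr_mem_extVerts (mem_range.1 hi))]

/-- **Clamping to `[0, 1]` (Mathlib's `Set.projIcc`) does not increase the energy.** [folklore] -/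
theorem dirE_projIcc_le (u : Site 2 ⊕ (Site 2 × Fin 4) → ℝ) :
    dirE E d₀ n (fun x ↦ (Set.projIcc (0 : ℝ) 1 zero_le_one (u x) : ℝ)) ≤ dirE E d₀ n u := by
  unfold dirE
  refine add_le_add (sum_le_sum fun e _ ↦ ?_) (sum_le_sum fun i _ ↦ ?_)
  · induction e using Sym2.ind with
    | h x y =>
      simp only [sqIncr_mk, Function.comp_apply]
      exact sq_le_sq.2 (Set.abs_projIcc_sub_projIcc zero_le_one)
  · simp only [dP]
    exact sq_le_sq.2 (Set.abs_projIcc_sub_projIcc zero_le_one)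

end RealEnergy

/-! ### The energy minimiser -/

section Minimizer

variable {E : Finset (Sym2 (Site 2))} {d₀ : Site 2 × Fin 4} {n : Fin 4 → ℕ}

/-- Disjoint position ranges give disjoint external arcs. [folklore] -/
theorem IsRect.disjoint_extArc (hR : IsRect E d₀ n) {j j' : Fin 4} (hjj : lo n j + n j ≤ lo n j')
    (hj' : lo n j' + n j' ≤ n 0 + n 1 + n 2 + n 3) :
    Disjoint (extArc E d₀ n j) (extArc E d₀ n j') := by
  rw [Set.disjoint_left]
  rintro _ ⟨i, hi1, hi2, rfl⟩ ⟨i', hi1', hi2', h⟩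
  have := hR.injOn i i' (by omega) (by omega) (Sum.inr_injective h)
  omega

/-- The external arcs `A = extArc 0` and `C = extArc 2` are disjoint. [folklore] -/
theorem IsRect.disjoint_extArc_zero_two (hR : IsRect E d₀ n) :
    Disjoint (extArc E d₀ n 0) (extArc E d₀ n 2) :=
  hR.disjoint_extArc (by simp [lo]) (by simp [lo])

/-- **Existence of the energy minimiser** for `(A_ext, C_ext)`: an admissible potential of least
real energy among ALL admissible potentials (compactness of the admissible `[0,1]`-valued
potentials on the finitely many vertices of `Ω̄`, continuity of the energy, and clamping).
[folklore] -/
theorem IsRect.exists_dirE_min (hR : IsRect E d₀ n) :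
    ∃ u : Site 2 ⊕ (Site 2 × Fin 4) → ℝ, (extArc E d₀ n 0).EqOn u 1 ∧ (extArc E d₀ n 2).EqOn u 0 ∧
      ∀ v : Site 2 ⊕ (Site 2 × Fin 4) → ℝ, (extArc E d₀ n 0).EqOn v 1 → (extArc E d₀ n 2).EqOn v 0 →
        dirE E d₀ n u ≤ dirE E d₀ n v := by
  classical
  set W := extVerts E d₀ n with hW
  set A := extArc E d₀ n 0 with hA
  set Z := extArc E d₀ n 2 with hZ
  -- evaluation of a function on `W` at a vertex of `Ω̄`, extended by zero
  let ev : (Site 2 ⊕ (Site 2 × Fin 4)) → (↥W → ℝ) → ℝ := fun v g ↦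
    if h : v ∈ W then g ⟨v, h⟩ else 0
  have hev : ∀ v, Continuous (ev v) := fun v ↦ by
    by_cases h : v ∈ W
    · have : ev v = fun g ↦ g ⟨v, h⟩ := funext fun g ↦ dif_pos h
      rw [this]; exact continuous_apply _
    · have : ev v = fun _ ↦ 0 := funext fun g ↦ dif_neg h
      rw [this]; exact continuous_const
  let Φ : (↥W → ℝ) → ℝ := fun g ↦ dirE E d₀ n (fun v ↦ ev v g)
  have hΦ : Continuous Φ := by
    refine Continuous.add (continuous_finsetSum _ fun e _ ↦ ?_)
      (continuous_finsetSum _ fun i _ ↦ ?_)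
    · induction e using Sym2.ind with
      | h x y => simp only [sqIncr_mk, Function.comp_apply]; fun_prop
    · simp only [dP]; fun_prop
  -- the compact set of admissible box-valued functions on `W`
  let K : Set (↥W → ℝ) := {g | (∀ v, g v ∈ Set.Icc (0 : ℝ) 1) ∧ (∀ v : ↥W, v.1 ∈ A → g v = 1) ∧
    ∀ v : ↥W, v.1 ∈ Z → g v = 0}
  have hK : IsCompact K := by
    have hbox : IsCompact (Set.pi Set.univ fun _ : ↥W ↦ Set.Icc (0 : ℝ) 1) :=
      isCompact_univ_pi fun _ ↦ isCompact_Icc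
    have hC1 : IsClosed {g : ↥W → ℝ | ∀ v : ↥W, v.1 ∈ A → g v = 1} := by
      rw [Set.setOf_forall]
      refine isClosed_iInter fun v ↦ ?_
      by_cases hv : v.1 ∈ A
      · simp only [hv, forall_true_left]; exact isClosed_eq (continuous_apply v) continuous_const
      · simp only [hv, IsEmpty.forall_iff, Set.setOf_true]; exact isClosed_univ
    have hC2 : IsClosed {g : ↥W → ℝ | ∀ v : ↥W, v.1 ∈ Z → g v = 0} := by
      rw [Set.setOf_forall]
      refine isClosed_iInter fun v ↦ ?_
      by_cases hv : v.1 ∈ Z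
      · simp only [hv, forall_true_left]; exact isClosed_eq (continuous_apply v) continuous_const
      · simp only [hv, IsEmpty.forall_iff, Set.setOf_true]; exact isClosed_univ
    have : K = (Set.pi Set.univ fun _ : ↥W ↦ Set.Icc (0 : ℝ) 1) ∩
        ({g : ↥W → ℝ | ∀ v : ↥W, v.1 ∈ A → g v = 1} ∩
          {g : ↥W → ℝ | ∀ v : ↥W, v.1 ∈ Z → g v = 0}) := by
      ext g
      simp only [K, Set.mem_setOf_eq, Set.mem_inter_iff, Set.mem_pi, Set.mem_univ, forall_true_left]
    rw [this]
    exact hbox.inter_right (hC1.inter hC2)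
  have hne : K.Nonempty := by
    refine ⟨fun v ↦ if v.1 ∈ A then 1 else 0, fun v ↦ ?_, fun v hv ↦ by simp [hv],
      fun v hv ↦ by
        have hvA : v.1 ∉ A := Set.disjoint_right.1 hR.disjoint_extArc_zero_two hv
        simp [hvA]⟩
    by_cases hv : v.1 ∈ A <;> simp [hv]
  obtain ⟨g, hgK, hmin⟩ := hK.exists_isMinOn hne hΦ.continuousOn
  -- the minimiser, extended by zero
  have hAW : A ⊆ ↑W := by
    rintro _ ⟨i, -, hi, rfl⟩
    exact inr_mem_extVerts (by simp only [lo, Matrix.cons_val_zero] at hi; omega)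
  have hZW : Z ⊆ ↑W := by
    rintro _ ⟨i, -, hi, rfl⟩
    exact inr_mem_extVerts (by simp only [lo] at hi; simp at hi; omega)
  refine ⟨fun v ↦ ev v g, fun v hv ↦ ?_, fun v hv ↦ ?_, fun v hvA hvZ ↦ ?_⟩
  · have hvW : v ∈ W := hAW hv
    simp only [ev, hvW, dite_true, Pi.one_apply]
    exact hgK.2.1 ⟨v, hvW⟩ hv
  · have hvW : v ∈ W := hZW hv
    simp only [ev, hvW, dite_true, Pi.zero_apply]
    exact hgK.2.2 ⟨v, hvW⟩ hv
  · -- compare with the clamped `v`, restricted to `W`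
    let g' : ↥W → ℝ := fun x ↦ (Set.projIcc (0 : ℝ) 1 zero_le_one (v x) : ℝ)
    have hg'K : g' ∈ K := ⟨fun x ↦ (Set.projIcc (0 : ℝ) 1 zero_le_one (v x)).2,
      fun x hx ↦ by simp [g', hvA hx, Set.projIcc_right],
      fun x hx ↦ by simp [g', hvZ hx, Set.projIcc_left]⟩
    have h1 : Φ g ≤ Φ g' := hmin hg'K
    have h2 : Φ g' = dirE E d₀ n (fun x ↦ (Set.projIcc (0 : ℝ) 1 zero_le_one (v x) : ℝ)) :=
      hR.dirE_congr fun x hx ↦ by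
        have hxW : x ∈ W := hx
        simp [ev, g', hxW]
    exact h1.trans (h2.trans_le (dirE_projIcc_le v))

end Minimizer

/-! ### Arrow form of the energy; first variation; harmonicity of the minimiser -/

section Harmonic

variable {E : Finset (Sym2 (Site 2))} {d₀ : Site 2 × Fin 4} {n : Fin 4 → ℕ}

/-- A lattice adjacency is an arrow. [folklore] -/
theorem exists_eq_add_dir_of_adj {p q : Site 2} (h : (zdGraph 2).Adj p q) : ∃ m : Fin 4, q = p + dir m := by
  rw [zdGraph_adj_iff] at h
  obtain ⟨i, h | h⟩ := h
  · fin_cases i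
    · exact ⟨0, by simpa [dir] using h⟩
    · exact ⟨1, by simpa [dir] using h⟩
  · fin_cases i
    · exact ⟨2, by rw [h]; simp [dir]⟩
    · exact ⟨3, by rw [h]; simp [dir]⟩

/-- **The two arrows of an edge**: for an edge `e` of a domain inside the lattice, the arrows of `E`
on `e` are an arrow `a₀` and its reverse. [folklore] -/
theorem exists_filter_aedge_eq (hE : ∀ e ∈ E, e ∈ (zdGraph 2).edgeSet) {e : Sym2 (Site 2)}
    (he : e ∈ E) : ∃ a₀ : Site 2 × Fin 4, aedge a₀ = e ∧
      (arrows E).filter (fun a ↦ aedge a = e) = {a₀, rev a₀} := by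
  classical
  induction e using Sym2.ind with
  | h p q =>
    obtain ⟨m, rfl⟩ := exists_eq_add_dir_of_adj ((SimpleGraph.mem_edgeSet _).1 (hE _ he))
    refine ⟨(p, m), rfl, ?_⟩
    ext a
    rw [mem_filter, mem_arrows, mem_insert, mem_singleton]
    constructor
    · rintro ⟨-, ha⟩
      exact eq_or_eq_rev_of_aedge_eq (b := (p, m)) ha
    · rintro (rfl | rfl)
      · exact ⟨he, rfl⟩
      · rw [aedge_rev]; exact ⟨he, rfl⟩

/-- **Sums over arrows, edge by edge**: `Σ_{arrows} g = Σ_{e ∈ E} (g a_e + g (rev a_e))` in the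
form needed here — if `g a + g (rev a)` only depends on the edge. [folklore] -/
theorem sum_arrows_eq_sum_edges (hE : ∀ e ∈ E, e ∈ (zdGraph 2).edgeSet) (g : Site 2 × Fin 4 → ℝ)
    (G : Sym2 (Site 2) → ℝ) (hG : ∀ a, aedge a ∈ E → g a + g (rev a) = G (aedge a)) :
    ∑ a ∈ arrows E, g a = ∑ e ∈ E, G e := by
  classical
  rw [← sum_fiberwise_of_maps_to (g := aedge) (t := E) (fun a ha ↦ mem_arrows.1 ha)]
  refine sum_congr rfl fun e he ↦ ?_
  obtain ⟨a₀, ha₀, hfib⟩ := exists_filter_aedge_eq hE he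
  rw [hfib, sum_pair (rev_ne a₀).symm, ← ha₀]
  exact hG a₀ (ha₀ ▸ he)

/-- **Arrow form of the edge energy**: `Σ_{arrows} du² = 2 Σ_{e ∈ E} du²`. [folklore] -/
theorem sum_arrows_dA_sq_eq (hE : ∀ e ∈ E, e ∈ (zdGraph 2).edgeSet)
    (u : Site 2 ⊕ (Site 2 × Fin 4) → ℝ) :
    ∑ a ∈ arrows E, dA u a ^ 2 = 2 * ∑ e ∈ E, sqIncr (u ∘ Sum.inl) e := by
  rw [mul_sum]
  refine sum_arrows_eq_sum_edges hE _ _ fun a _ ↦ ?_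
  obtain ⟨p, m⟩ := a
  simp only [dA, rev_mk, dir_add_two, add_neg_cancel_right, aedge_mk, sqIncr_mk, Function.comp_apply]
  ring

/-- The increment along the reversed arrow. [folklore] -/
theorem dA_rev (u : Site 2 ⊕ (Site 2 × Fin 4) → ℝ) (a : Site 2 × Fin 4) : dA u (rev a) = -dA u a := by
  obtain ⟨p, m⟩ := a
  simp only [dA, rev_mk, dir_add_two, add_neg_cancel_right]
  ring

/-- **The outgoing current at a lattice vertex** (`-Δu(x)` on `Ω̄`): the sum of `u x - u y` over the
lattice edges of `E` at `x` and over the pendant edges at `x` (darts of the cycle based at `x`).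
[folklore] -/
def lap (E : Finset (Sym2 (Site 2))) (d₀ : Site 2 × Fin 4) (n : Fin 4 → ℕ)
    (u : Site 2 ⊕ (Site 2 × Fin 4) → ℝ) (x : Site 2) : ℝ :=
  -∑ a ∈ (arrows E).filter (fun a ↦ a.1 = x), dA u a +
    ∑ i ∈ (range (n 0 + n 1 + n 2 + n 3)).filter (fun i ↦ ((succ E)^[i] d₀).1 = x),
      dP u ((succ E)^[i] d₀)

/-- `Σ_{arrows ending at x} du = -Σ_{arrows starting at x} du` (reversal). [folklore] -/
theorem sum_dA_end_eq (u : Site 2 ⊕ (Site 2 × Fin 4) → ℝ) (x : Site 2) :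
    ∑ a ∈ arrows E, (if a.1 + dir a.2 = x then dA u a else 0) =
      -∑ a ∈ arrows E, (if a.1 = x then dA u a else 0) := by
  have h := sum_arrows_rev (E := E) (fun a ↦ if a.1 = x then dA u (rev a) else 0)
  simp only [rev_rev] at h
  calc ∑ a ∈ arrows E, (if a.1 + dir a.2 = x then dA u a else 0)
      = ∑ a ∈ arrows E, (if (rev a).1 = x then dA u a else 0) := sum_congr rfl fun a _ ↦ rfl
    _ = ∑ a ∈ arrows E, (if a.1 = x then dA u (rev a) else 0) := h
    _ = -∑ a ∈ arrows E, (if a.1 = x then dA u a else 0) := by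
        rw [← sum_neg_distrib]
        refine sum_congr rfl fun a _ ↦ ?_
        rw [dA_rev]
        split_ifs <;> simp

/-- **Stationarity**: if `a ≤ a + 2tL + t²c` for every real `t` (the energy of a minimiser
against its one-parameter perturbations), then the linear coefficient `L` vanishes. [folklore] -/
theorem eq_zero_of_forall_le_add_quad {a L c : ℝ} (h0 : ∀ t : ℝ, a ≤ a + 2 * t * L + t ^ 2 * c) :
    L = 0 := by
  have h : ∀ t : ℝ, 0 ≤ 2 * t * L + t ^ 2 * c := fun t ↦ by linarith [h0 t]
  by_contra hL
  have hc : 0 ≤ c := by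
    have h1 := h 1
    have h2 := h (-1)
    nlinarith
  have hLpos : 0 < |L| := abs_pos.2 hL
  set t := |L| / (c + 1) with ht_def
  have ht : 0 < t := by positivity
  have h3 : 2 * t * |L| ≤ t ^ 2 * c := by
    rcases le_or_gt 0 L with hl | hl
    · rw [abs_of_nonneg hl]
      have := h (-t)
      nlinarith
    · rw [abs_of_neg hl]
      have := h t
      nlinarith
  have h5 : 2 * |L| ≤ t * c :=
    le_of_mul_le_mul_left (by nlinarith [h3] : t * (2 * |L|) ≤ t * (t * c)) ht
  have h6 : t * c ≤ |L| := by
    have : c / (c + 1) ≤ 1 := (div_le_one (by linarith)).2 (by linarith)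
    calc t * c = |L| * (c / (c + 1)) := by rw [ht_def]; ring
      _ ≤ |L| * 1 := mul_le_mul_of_nonneg_left this hLpos.le
      _ = |L| := mul_one _
  linarith

/-- **Arrow form of the real energy.** [folklore] -/
theorem IsRect.dirE_eq_arrows (hR : IsRect E d₀ n) (u : Site 2 ⊕ (Site 2 × Fin 4) → ℝ) :
    dirE E d₀ n u = (1 / 2) * ∑ a ∈ arrows E, dA u a ^ 2 +
      ∑ i ∈ range (n 0 + n 1 + n 2 + n 3), dP u ((succ E)^[i] d₀) ^ 2 := by
  rw [dirE, sum_arrows_dA_sq_eq hR.subset_edgeSet]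
  ring

/-- **First variation at a lattice vertex**: perturbing `u` by `t` at `inl x` changes the energy by
`2t·lap(x) + t²·c`. [folklore] -/
theorem IsRect.dirE_add_bump_inl (hR : IsRect E d₀ n) (u : Site 2 ⊕ (Site 2 × Fin 4) → ℝ)
    (x : Site 2) : ∃ c : ℝ, ∀ t : ℝ,
      dirE E d₀ n (fun v ↦ u v + if v = .inl x then t else 0) =
        dirE E d₀ n u + 2 * t * lap E d₀ n u x + t ^ 2 * c := by
  classical
  set η : Site 2 × Fin 4 → ℝ := fun a ↦ (if a.1 + dir a.2 = x then 1 else 0) - if a.1 = x then 1 else 0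
    with hη
  set θ : ℕ → ℝ := fun i ↦ if ((succ E)^[i] d₀).1 = x then 1 else 0 with hθ
  refine ⟨(1 / 2) * ∑ a ∈ arrows E, η a ^ 2 + ∑ i ∈ range (n 0 + n 1 + n 2 + n 3), θ i ^ 2,
    fun t ↦ ?_⟩
  have hA : ∀ a, dA (fun v ↦ u v + if v = .inl x then t else 0) a = dA u a + t * η a := fun a ↦ by
    simp only [dA, hη, Sum.inl.injEq]
    split_ifs <;> ring
  have hP : ∀ i, dP (fun v ↦ u v + if v = .inl x then t else 0) ((succ E)^[i] d₀) =
      dP u ((succ E)^[i] d₀) + t * θ i := fun i ↦ by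
    simp only [dP, hθ, Sum.inl.injEq, reduceCtorEq, if_false, add_zero]
    split_ifs <;> ring
  have hlap : lap E d₀ n u x = (1 / 2) * ∑ a ∈ arrows E, η a * dA u a +
      ∑ i ∈ range (n 0 + n 1 + n 2 + n 3), θ i * dP u ((succ E)^[i] d₀) := by
    unfold lap
    rw [sum_filter, sum_filter]
    have h1 : ∑ a ∈ arrows E, η a * dA u a = ∑ a ∈ arrows E, (if a.1 + dir a.2 = x then dA u a else 0) -
        ∑ a ∈ arrows E, (if a.1 = x then dA u a else 0) := by
      rw [← sum_sub_distrib]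
      refine sum_congr rfl fun a _ ↦ ?_
      simp only [hη]
      split_ifs <;> ring
    rw [h1, sum_dA_end_eq]
    have h2 : ∑ i ∈ range (n 0 + n 1 + n 2 + n 3), θ i * dP u ((succ E)^[i] d₀) =
        ∑ i ∈ range (n 0 + n 1 + n 2 + n 3),
          (if ((succ E)^[i] d₀).1 = x then dP u ((succ E)^[i] d₀) else 0) :=
      sum_congr rfl fun i _ ↦ by simp only [hθ]; split_ifs <;> ring
    rw [h2]
    ring
  rw [hR.dirE_eq_arrows, hR.dirE_eq_arrows, hlap]
  simp only [hA, hP]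
  have e1 : ∑ a ∈ arrows E, (dA u a + t * η a) ^ 2 =
      ∑ a ∈ arrows E, dA u a ^ 2 + 2 * t * ∑ a ∈ arrows E, η a * dA u a +
        t ^ 2 * ∑ a ∈ arrows E, η a ^ 2 := by
    rw [mul_sum, mul_sum, ← sum_add_distrib, ← sum_add_distrib]
    exact sum_congr rfl fun a _ ↦ by ring
  have e2 : ∑ i ∈ range (n 0 + n 1 + n 2 + n 3), (dP u ((succ E)^[i] d₀) + t * θ i) ^ 2 =
      ∑ i ∈ range (n 0 + n 1 + n 2 + n 3), dP u ((succ E)^[i] d₀) ^ 2 +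
        2 * t * ∑ i ∈ range (n 0 + n 1 + n 2 + n 3), θ i * dP u ((succ E)^[i] d₀) +
        t ^ 2 * ∑ i ∈ range (n 0 + n 1 + n 2 + n 3), θ i ^ 2 := by
    rw [mul_sum, mul_sum, ← sum_add_distrib, ← sum_add_distrib]
    exact sum_congr rfl fun i _ ↦ by ring
  rw [e1, e2]
  ring

/-- **First variation at an external vertex of the cycle**: perturbing `u` by `t` at `inr (d_j)`
changes the energy by `-2t·dP_j + t²`. [folklore] -/
theorem IsRect.dirE_add_bump_inr (hR : IsRect E d₀ n) (u : Site 2 ⊕ (Site 2 × Fin 4) → ℝ)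
    {j : ℕ} (hj : j < n 0 + n 1 + n 2 + n 3) (t : ℝ) :
    dirE E d₀ n (fun v ↦ u v + if v = .inr ((succ E)^[j] d₀) then t else 0) =
      dirE E d₀ n u + 2 * t * (-dP u ((succ E)^[j] d₀)) + t ^ 2 * 1 := by
  classical
  have hA : ∀ a, dA (fun v ↦ u v + if v = .inr ((succ E)^[j] d₀) then t else 0) a = dA u a :=
    fun a ↦ by simp [dA]
  have hP : ∀ i ∈ range (n 0 + n 1 + n 2 + n 3),
      dP (fun v ↦ u v + if v = .inr ((succ E)^[j] d₀) then t else 0) ((succ E)^[i] d₀) =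
        dP u ((succ E)^[i] d₀) - if i = j then t else 0 := by
    intro i hi
    have hiff : (succ E)^[i] d₀ = (succ E)^[j] d₀ ↔ i = j :=
      ⟨fun h ↦ hR.injOn i j (mem_range.1 hi) hj h, fun h ↦ by rw [h]⟩
    simp only [dP, Sum.inr.injEq, reduceCtorEq, if_false, add_zero, hiff]
    split_ifs <;> ring
  rw [hR.dirE_eq_arrows, hR.dirE_eq_arrows]
  simp only [hA]
  have e1 : ∑ i ∈ range (n 0 + n 1 + n 2 + n 3),
      dP (fun v ↦ u v + if v = .inr ((succ E)^[j] d₀) then t else 0) ((succ E)^[i] d₀) ^ 2 =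
      ∑ i ∈ range (n 0 + n 1 + n 2 + n 3), (dP u ((succ E)^[i] d₀) - if i = j then t else 0) ^ 2 :=
    sum_congr rfl fun i hi ↦ by rw [hP i hi]
  have e2 : ∑ i ∈ range (n 0 + n 1 + n 2 + n 3), (dP u ((succ E)^[i] d₀) - if i = j then t else 0) ^ 2 =
      ∑ i ∈ range (n 0 + n 1 + n 2 + n 3), dP u ((succ E)^[i] d₀) ^ 2 +
        ∑ i ∈ range (n 0 + n 1 + n 2 + n 3),
          (if i = j then -2 * t * dP u ((succ E)^[i] d₀) + t ^ 2 else 0) := by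
    rw [← sum_add_distrib]
    exact sum_congr rfl fun i _ ↦ by split_ifs <;> ring
  rw [e1, e2, sum_ite_eq' (range (n 0 + n 1 + n 2 + n 3)) j, if_pos (mem_range.2 hj)]
  ring

/-- **The minimiser is harmonic at every lattice vertex**: `lap u x = 0`. [folklore] -/
theorem IsRect.lap_eq_zero_of_min (hR : IsRect E d₀ n) {u : Site 2 ⊕ (Site 2 × Fin 4) → ℝ}
    (huA : (extArc E d₀ n 0).EqOn u 1) (huC : (extArc E d₀ n 2).EqOn u 0)
    (hmin : ∀ v : Site 2 ⊕ (Site 2 × Fin 4) → ℝ, (extArc E d₀ n 0).EqOn v 1 →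
      (extArc E d₀ n 2).EqOn v 0 → dirE E d₀ n u ≤ dirE E d₀ n v) (x : Site 2) :
    lap E d₀ n u x = 0 := by
  obtain ⟨c, hc⟩ := hR.dirE_add_bump_inl u x
  refine eq_zero_of_forall_le_add_quad (a := dirE E d₀ n u) (c := c) fun t ↦ ?_
  have h := hmin (fun v ↦ u v + if v = .inl x then t else 0) ?_ ?_
  · rwa [hc t] at h
  · rintro _ ⟨i, h1, h2, rfl⟩
    simp only [reduceCtorEq, if_false, add_zero]
    exact huA ⟨i, h1, h2, rfl⟩
  · rintro _ ⟨i, h1, h2, rfl⟩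
    simp only [reduceCtorEq, if_false, add_zero]
    exact huC ⟨i, h1, h2, rfl⟩

/-- **The minimiser is harmonic at the free external vertices**: the pendant current vanishes at the
positions of the arcs `B` and `D`. [folklore] -/
theorem IsRect.dP_eq_zero_of_min (hR : IsRect E d₀ n) {u : Site 2 ⊕ (Site 2 × Fin 4) → ℝ}
    (huA : (extArc E d₀ n 0).EqOn u 1) (huC : (extArc E d₀ n 2).EqOn u 0)
    (hmin : ∀ v : Site 2 ⊕ (Site 2 × Fin 4) → ℝ, (extArc E d₀ n 0).EqOn v 1 →
      (extArc E d₀ n 2).EqOn v 0 → dirE E d₀ n u ≤ dirE E d₀ n v) {j : ℕ}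
    (hj : (n 0 ≤ j ∧ j < n 0 + n 1) ∨ (n 0 + n 1 + n 2 ≤ j ∧ j < n 0 + n 1 + n 2 + n 3)) :
    dP u ((succ E)^[j] d₀) = 0 := by
  have hjN : j < n 0 + n 1 + n 2 + n 3 := by omega
  have key : -dP u ((succ E)^[j] d₀) = 0 := by
    refine eq_zero_of_forall_le_add_quad (a := dirE E d₀ n u) (c := 1) fun t ↦ ?_
    have h := hmin (fun v ↦ u v + if v = .inr ((succ E)^[j] d₀) then t else 0) ?_ ?_
    · rw [hR.dirE_add_bump_inr u hjN t] at h; linarith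
    · rintro _ ⟨i, h1, h2, rfl⟩
      have hne : (succ E)^[i] d₀ ≠ (succ E)^[j] d₀ := fun h ↦ by
        have := hR.injOn i j (by simp [lo] at h2; omega) hjN h
        simp [lo] at h1 h2; omega
      simp only [Sum.inr.injEq, hne, if_false, add_zero]
      exact huA ⟨i, h1, h2, rfl⟩
    · rintro _ ⟨i, h1, h2, rfl⟩
      have hne : (succ E)^[i] d₀ ≠ (succ E)^[j] d₀ := fun h ↦ by
        have := hR.injOn i j (by simp [lo] at h2; omega) hjN h
        simp [lo] at h1 h2; omega
      simp only [Sum.inr.injEq, hne, if_false, add_zero]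
      exact huC ⟨i, h1, h2, rfl⟩
  linarith

end Harmonic

/-! ### The discrete Green formula: energy = current -/

section Green

variable {E : Finset (Sym2 (Site 2))} {d₀ : Site 2 × Fin 4} {n : Fin 4 → ℕ}

/-- `Σ_{arrows} du² = -2 Σ_{arrows} u(start) du` (reversal). [folklore] -/
theorem sum_dA_sq_eq_neg_two_mul (u : Site 2 ⊕ (Site 2 × Fin 4) → ℝ) :
    ∑ a ∈ arrows E, dA u a ^ 2 = -2 * ∑ a ∈ arrows E, u (.inl a.1) * dA u a := by
  have h := sum_arrows_rev (E := E) (fun a ↦ u (.inl a.1) * dA u (rev a))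
  simp only [rev_rev, dA_rev, mul_neg, sum_neg_distrib] at h
  -- `h : Σ u(end a) · (-(-dA a))`… unfold carefully
  have h1 : ∑ a ∈ arrows E, dA u a ^ 2 =
      ∑ a ∈ arrows E, u (.inl (rev a).1) * dA u a - ∑ a ∈ arrows E, u (.inl a.1) * dA u a := by
    rw [← sum_sub_distrib]
    refine sum_congr rfl fun a _ ↦ ?_
    obtain ⟨p, m⟩ := a
    simp only [dA, rev_mk]
    ring
  rw [h1]
  have h2 : ∑ a ∈ arrows E, u (.inl (rev a).1) * dA u a = -∑ a ∈ arrows E, u (.inl a.1) * dA u a := by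
    have h' := sum_arrows_rev (E := E) (fun a ↦ u (.inl a.1) * dA u (rev a))
    simp only [rev_rev] at h'
    rw [h', ← sum_neg_distrib]
    exact sum_congr rfl fun a _ ↦ by rw [dA_rev]; ring
  rw [h2]
  ring

/-- Sums over one period split into the four arcs. [folklore] -/
theorem sum_range_four_blocks (f : ℕ → ℝ) (n₀ n₁ n₂ n₃ : ℕ) :
    ∑ i ∈ range (n₀ + n₁ + n₂ + n₃), f i = ∑ i ∈ range n₀, f i + ∑ i ∈ Ico n₀ (n₀ + n₁), f i +
      ∑ i ∈ Ico (n₀ + n₁) (n₀ + n₁ + n₂), f i + ∑ i ∈ Ico (n₀ + n₁ + n₂) (n₀ + n₁ + n₂ + n₃), f i := by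
  rw [range_eq_Ico, ← sum_Ico_consecutive f (Nat.zero_le n₀) (show n₀ ≤ n₀ + n₁ + n₂ + n₃ by omega),
    ← sum_Ico_consecutive f (show n₀ ≤ n₀ + n₁ by omega) (show n₀ + n₁ ≤ n₀ + n₁ + n₂ + n₃ by omega),
    ← sum_Ico_consecutive f (show n₀ + n₁ ≤ n₀ + n₁ + n₂ by omega)
      (show n₀ + n₁ + n₂ ≤ n₀ + n₁ + n₂ + n₃ by omega), range_eq_Ico]
  ring

/-- **Discrete Green formula**: for a potential harmonic at all lattice vertices and at the
external vertices of `B` and `D`, with boundary values `1` on `A_ext` and `0` on `C_ext`, the energy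
is the total current through the pendant edges of `A`: `ℰ(u) = Σ_{i ∈ A} (1 - u(x_i)) = -Σ_{i<n₀} dP_i`.
[cite: Chelkak2016, Prop. 6.4 (discrete integration by parts)] -/
theorem IsRect.dirE_eq_current (hR : IsRect E d₀ n) {u : Site 2 ⊕ (Site 2 × Fin 4) → ℝ}
    (hlap : ∀ x, lap E d₀ n u x = 0)
    (hB : ∀ i, n 0 ≤ i → i < n 0 + n 1 → dP u ((succ E)^[i] d₀) = 0)
    (hD : ∀ i, n 0 + n 1 + n 2 ≤ i → i < n 0 + n 1 + n 2 + n 3 → dP u ((succ E)^[i] d₀) = 0)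
    (huA : ∀ i < n 0, u (.inr ((succ E)^[i] d₀)) = 1)
    (huC : ∀ i, n 0 + n 1 ≤ i → i < n 0 + n 1 + n 2 → u (.inr ((succ E)^[i] d₀)) = 0) :
    dirE E d₀ n u = -∑ i ∈ range (n 0), dP u ((succ E)^[i] d₀) := by
  classical
  rw [hR.dirE_eq_arrows, sum_dA_sq_eq_neg_two_mul]
  -- edge part, vertex by vertex
  have hE : ∑ a ∈ arrows E, u (.inl a.1) * dA u a =
      ∑ x ∈ verts E, u (.inl x) * ∑ a ∈ (arrows E).filter (fun a ↦ a.1 = x), dA u a := by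
    rw [← sum_fiberwise_of_maps_to (g := Prod.fst) (t := verts E)
      (fun a ha ↦ fst_mem_verts_of_aedge_mem (mem_arrows.1 ha))]
    refine sum_congr rfl fun x _ ↦ ?_
    rw [mul_sum]
    refine sum_congr rfl fun a ha ↦ ?_
    rw [(mem_filter.1 ha).2]
  -- pendant part, vertex by vertex
  have hP : ∑ i ∈ range (n 0 + n 1 + n 2 + n 3), dP u ((succ E)^[i] d₀) ^ 2 =
      ∑ x ∈ verts E, u (.inl x) *
          ∑ i ∈ (range (n 0 + n 1 + n 2 + n 3)).filter (fun i ↦ ((succ E)^[i] d₀).1 = x),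
            dP u ((succ E)^[i] d₀) -
        ∑ i ∈ range (n 0 + n 1 + n 2 + n 3), u (.inr ((succ E)^[i] d₀)) * dP u ((succ E)^[i] d₀) := by
    have e0 : ∑ i ∈ range (n 0 + n 1 + n 2 + n 3), dP u ((succ E)^[i] d₀) ^ 2 =
        ∑ i ∈ range (n 0 + n 1 + n 2 + n 3), u (.inl ((succ E)^[i] d₀).1) * dP u ((succ E)^[i] d₀) -
        ∑ i ∈ range (n 0 + n 1 + n 2 + n 3), u (.inr ((succ E)^[i] d₀)) * dP u ((succ E)^[i] d₀) := by
      rw [← sum_sub_distrib]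
      exact sum_congr rfl fun i _ ↦ by simp only [dP]; ring
    have e1 : ∑ i ∈ range (n 0 + n 1 + n 2 + n 3), u (.inl ((succ E)^[i] d₀).1) * dP u ((succ E)^[i] d₀) =
        ∑ x ∈ verts E, ∑ i ∈ (range (n 0 + n 1 + n 2 + n 3)).filter (fun i ↦ ((succ E)^[i] d₀).1 = x),
          u (.inl ((succ E)^[i] d₀).1) * dP u ((succ E)^[i] d₀) :=
      (sum_fiberwise_of_maps_to (g := fun i ↦ ((succ E)^[i] d₀).1)
        (fun i _ ↦ (hR.isExtDart_iterate i).1) _).symm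
    have e2 : ∀ x, ∑ i ∈ (range (n 0 + n 1 + n 2 + n 3)).filter (fun i ↦ ((succ E)^[i] d₀).1 = x),
          u (.inl ((succ E)^[i] d₀).1) * dP u ((succ E)^[i] d₀) =
        u (.inl x) * ∑ i ∈ (range (n 0 + n 1 + n 2 + n 3)).filter (fun i ↦ ((succ E)^[i] d₀).1 = x),
          dP u ((succ E)^[i] d₀) := fun x ↦ by
      rw [mul_sum]
      exact sum_congr rfl fun i hi ↦ by rw [(mem_filter.1 hi).2]
    rw [e0, e1, sum_congr rfl fun x _ ↦ e2 x]
  have hcomb : (1 / 2 : ℝ) * (-2 * ∑ a ∈ arrows E, u (.inl a.1) * dA u a) +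
      ∑ i ∈ range (n 0 + n 1 + n 2 + n 3), dP u ((succ E)^[i] d₀) ^ 2 =
      ∑ x ∈ verts E, u (.inl x) * lap E d₀ n u x -
        ∑ i ∈ range (n 0 + n 1 + n 2 + n 3), u (.inr ((succ E)^[i] d₀)) * dP u ((succ E)^[i] d₀) := by
    rw [hE, hP]
    simp only [lap, mul_add, mul_neg, sum_add_distrib, sum_neg_distrib]
    ring
  rw [hcomb, sum_congr rfl fun x _ ↦ by rw [hlap x, mul_zero], sum_const_zero, zero_sub,
    sum_range_four_blocks]
  have sA : ∑ i ∈ range (n 0), u (.inr ((succ E)^[i] d₀)) * dP u ((succ E)^[i] d₀) =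
      ∑ i ∈ range (n 0), dP u ((succ E)^[i] d₀) :=
    sum_congr rfl fun i hi ↦ by rw [huA i (mem_range.1 hi), one_mul]
  have sB : ∑ i ∈ Ico (n 0) (n 0 + n 1), u (.inr ((succ E)^[i] d₀)) * dP u ((succ E)^[i] d₀) = 0 :=
    sum_eq_zero fun i hi ↦ by rw [mem_Ico] at hi; rw [hB i hi.1 hi.2, mul_zero]
  have sC : ∑ i ∈ Ico (n 0 + n 1) (n 0 + n 1 + n 2),
      u (.inr ((succ E)^[i] d₀)) * dP u ((succ E)^[i] d₀) = 0 :=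
    sum_eq_zero fun i hi ↦ by rw [mem_Ico] at hi; rw [huC i hi.1 hi.2, zero_mul]
  have sD : ∑ i ∈ Ico (n 0 + n 1 + n 2) (n 0 + n 1 + n 2 + n 3),
      u (.inr ((succ E)^[i] d₀)) * dP u ((succ E)^[i] d₀) = 0 :=
    sum_eq_zero fun i hi ↦ by rw [mem_Ico] at hi; rw [hD i hi.1 hi.2, mul_zero]
  rw [sA, sB, sC, sD]
  ring

/-- The total pendant current of a potential harmonic at the lattice vertices vanishes. [folklore] -/
theorem IsRect.sum_dP_eq_zero (hR : IsRect E d₀ n) {u : Site 2 ⊕ (Site 2 × Fin 4) → ℝ}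
    (hlap : ∀ x, lap E d₀ n u x = 0) :
    ∑ i ∈ range (n 0 + n 1 + n 2 + n 3), dP u ((succ E)^[i] d₀) = 0 := by
  classical
  have h1 : ∑ i ∈ range (n 0 + n 1 + n 2 + n 3), dP u ((succ E)^[i] d₀) =
      ∑ x ∈ verts E, ∑ i ∈ (range (n 0 + n 1 + n 2 + n 3)).filter (fun i ↦ ((succ E)^[i] d₀).1 = x),
        dP u ((succ E)^[i] d₀) :=
    (sum_fiberwise_of_maps_to (g := fun i ↦ ((succ E)^[i] d₀).1)
      (fun i _ ↦ (hR.isExtDart_iterate i).1) _).symm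
  have h2 : ∀ x, ∑ i ∈ (range (n 0 + n 1 + n 2 + n 3)).filter (fun i ↦ ((succ E)^[i] d₀).1 = x),
      dP u ((succ E)^[i] d₀) = ∑ a ∈ (arrows E).filter (fun a ↦ a.1 = x), dA u a := fun x ↦ by
    have := hlap x; unfold lap at this; linarith
  have h3 : ∑ x ∈ verts E, ∑ a ∈ (arrows E).filter (fun a ↦ a.1 = x), dA u a = ∑ a ∈ arrows E, dA u a :=
    sum_fiberwise_of_maps_to (fun a ha ↦ fst_mem_verts_of_aedge_mem (mem_arrows.1 ha)) _
  have h4 : ∑ a ∈ arrows E, dA u a = 0 := by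
    have h := sum_arrows_rev (E := E) (dA u)
    simp only [dA_rev, sum_neg_distrib] at h
    linarith
  rw [h1, sum_congr rfl fun x _ ↦ h2 x, h3, h4]

end Green

/-! ### The completed current cycle and its winding potential -/

section Cycle

variable {E : Finset (Sym2 (Site 2))} {d₀ : Site 2 × Fin 4} {n : Fin 4 → ℕ}

/-- **Path property of a segment**: the arrows of the segment from `d` telescope from `d.1` to
`(succ E d).1`. [folklore] -/
theorem sum_slots_sub (f : Site 2 → ℝ) (d : Site 2 × Fin 4) :
    ∑ a ∈ slots E d, (f a.1 - f (a.1 + dir a.2)) = f d.1 - f (succ E d).1 := by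
  rw [sum_slots_eq_ite]
  unfold DiscreteRect.succ
  dsimp only
  split_ifs <;> ring

/-- **The exterior square of the successor dart is the exterior square of the dart, seen from the
new dart**: `rsq (succ E d) = quad d.1 d.2` (the trace keeps the exterior on its right).
[folklore] -/
theorem rsq_succ (d : Site 2 × Fin 4) : rsq (succ E d) = quad d.1 d.2 := by
  have k1 : ∀ k : Fin 4, k + 1 + 3 = k := by decide
  have k3 : ∀ k : Fin 4, k - 1 + 3 = k + 2 := by decide
  have k4 : ∀ k : Fin 4, k - 2 + 3 = k + 1 := by decide
  unfold DiscreteRect.succ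
  dsimp only
  split_ifs
  · rw [rsq_mk, k4]
    have e1 : d.1 + dir (d.2 + 1) + dir d.2 + dir (d.2 - 1) = d.1 + dir d.2 := by
      rw [dir_sub_one]; abel
    rw [e1]
    exact quad_add_dir d.1 d.2
  · rw [rsq_mk, k3, add_right_comm]
    exact quad_add_dir_add_dir d.1 d.2
  · rw [rsq_mk]
    exact quad_add_dir_add_one d.1 d.2
  · rw [rsq_mk, k1]

/-- **The cumulative pendant current** `Q_j = -Σ_{l<j} dP_l` along the boundary cycle (the value of
the harmonic conjugate on the boundary position `j - 1`, up to sign). [folklore] -/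
def Qcum (E : Finset (Sym2 (Site 2))) (d₀ : Site 2 × Fin 4) (u : Site 2 ⊕ (Site 2 × Fin 4) → ℝ)
    (j : ℕ) : ℝ :=
  -∑ l ∈ range j, dP u ((succ E)^[l] d₀)

/-- **The current along an arrow** (`u(start) - u(end)` on the edges of `E`, zero elsewhere).
[folklore] -/
def cur (E : Finset (Sym2 (Site 2))) (u : Site 2 ⊕ (Site 2 × Fin 4) → ℝ) (b : Site 2 × Fin 4) : ℝ :=
  if aedge b ∈ E then -dA u b else 0

/-- **The completed current cycle**: the current of `u` minus, for every position `j` of the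
boundary cycle, `Q_{j+1}` times the (signed) indicator of the arrows of its segment. [folklore] -/
def zeta (E : Finset (Sym2 (Site 2))) (d₀ : Site 2 × Fin 4) (n : Fin 4 → ℕ)
    (u : Site 2 ⊕ (Site 2 × Fin 4) → ℝ) (b : Site 2 × Fin 4) : ℝ :=
  cur E u b - ∑ j ∈ range (n 0 + n 1 + n 2 + n 3), Qcum E d₀ u (j + 1) *
    ∑ a ∈ slots E ((succ E)^[j] d₀), ((if a = b then (1 : ℝ) else 0) - if a = rev b then 1 else 0)

variable {u : Site 2 ⊕ (Site 2 × Fin 4) → ℝ}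

/-- `Q_0 = 0`. [folklore] -/
@[simp] theorem Qcum_zero : Qcum E d₀ u 0 = 0 := by simp [Qcum]

/-- `Q_{j+1} - Q_j = -dP_j`. [folklore] -/
theorem Qcum_succ (j : ℕ) : Qcum E d₀ u (j + 1) = Qcum E d₀ u j - dP u ((succ E)^[j] d₀) := by
  rw [Qcum, Qcum, sum_range_succ]; ring

/-- The current is antisymmetric. [folklore] -/
theorem cur_rev (b : Site 2 × Fin 4) : cur E u (rev b) = -cur E u b := by
  simp only [cur, aedge_rev, dA_rev]
  split_ifs <;> ring

/-- The completed cycle is antisymmetric. [folklore] -/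
theorem zeta_rev (b : Site 2 × Fin 4) : zeta E d₀ n u (rev b) = -zeta E d₀ n u b := by
  unfold zeta
  rw [cur_rev, rev_rev]
  have h : ∀ j ∈ range (n 0 + n 1 + n 2 + n 3), Qcum E d₀ u (j + 1) *
      ∑ a ∈ slots E ((succ E)^[j] d₀), ((if a = rev b then (1 : ℝ) else 0) - if a = b then 1 else 0) =
      -(Qcum E d₀ u (j + 1) *
        ∑ a ∈ slots E ((succ E)^[j] d₀), ((if a = b then (1 : ℝ) else 0) - if a = rev b then 1 else 0)) :=
    fun j _ ↦ by
      rw [← mul_neg, ← sum_neg_distrib]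
      congr 1
      exact sum_congr rfl fun a _ ↦ by ring
  rw [sum_congr rfl h, sum_neg_distrib]
  ring

/-- The completed cycle lives on the arrows of `E`. [folklore] -/
theorem aedge_mem_of_zeta_ne_zero {b : Site 2 × Fin 4} (h : zeta E d₀ n u b ≠ 0) : aedge b ∈ E := by
  by_contra hb
  apply h
  unfold zeta cur
  rw [if_neg hb, zero_sub, neg_eq_zero]
  refine sum_eq_zero fun j _ ↦ ?_
  rw [sum_eq_zero fun a ha ↦ ?_, mul_zero]
  have h1 : a ≠ b := fun hab ↦ hb (hab ▸ aedge_mem_of_mem_slots ha)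
  have h2 : a ≠ rev b := fun hab ↦ hb (by rw [← aedge_rev, ← hab]; exact aedge_mem_of_mem_slots ha)
  simp [h1, h2]

/-- `Σ_m [a = (p, m)] = [a.1 = p]`. [folklore] -/
theorem sum_ite_eq_mk (a : Site 2 × Fin 4) (p : Site 2) :
    ∑ m : Fin 4, (if a = (p, m) then (1 : ℝ) else 0) = if a.1 = p then 1 else 0 := by
  obtain ⟨q, l⟩ := a
  by_cases h : q = p
  · subst h
    simp [Prod.ext_iff]
  · simp [Prod.ext_iff, h]

/-- `Σ_m [a = rev (p, m)] = [a.1 + e_{a.2} = p]`. [folklore] -/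
theorem sum_ite_eq_rev_mk (a : Site 2 × Fin 4) (p : Site 2) :
    ∑ m : Fin 4, (if a = rev (p, m) then (1 : ℝ) else 0) = if a.1 + dir a.2 = p then 1 else 0 := by
  have h : ∀ m, a = rev (p, m) ↔ rev a = (p, m) := fun m ↦
    ⟨fun h ↦ by rw [h, rev_rev], fun h ↦ by rw [← h, rev_rev]⟩
  simp_rw [h]
  rw [sum_ite_eq_mk]
  rfl

/-- **The completed cycle is divergence-free** when `u` is harmonic at the lattice vertices.
[folklore] -/
theorem IsRect.sum_zeta_eq_zero (hR : IsRect E d₀ n) (hlap : ∀ x, lap E d₀ n u x = 0) (p : Site 2) :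
    ∑ m : Fin 4, zeta E d₀ n u (p, m) = 0 := by
  classical
  -- the current part
  have hcur : ∑ m : Fin 4, cur E u (p, m) = -∑ a ∈ (arrows E).filter (fun a ↦ a.1 = p), dA u a := by
    unfold cur
    rw [← sum_filter, ← sum_neg_distrib]
    refine sum_nbij' (fun m ↦ (p, m)) Prod.snd ?_ ?_ (fun _ _ ↦ rfl) ?_ (fun _ _ ↦ rfl)
    · intro m hm
      rw [mem_filter] at hm ⊢
      exact ⟨mem_arrows.2 hm.2, rfl⟩
    · rintro ⟨q, l⟩ ha
      rw [mem_filter] at ha ⊢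
      obtain ⟨ha, rfl⟩ := ha
      exact ⟨mem_univ _, mem_arrows.1 ha⟩
    · rintro ⟨q, l⟩ ha
      rw [mem_filter] at ha
      obtain ⟨-, rfl⟩ := ha
      rfl
  -- the segment part: `Σ_m Σ_a ([a = (p,m)] - [a = rev (p,m)]) = [x_j = p] - [x_{j+1} = p]`
  have hseg : ∀ j, ∑ m : Fin 4, ∑ a ∈ slots E ((succ E)^[j] d₀),
      ((if a = (p, m) then (1 : ℝ) else 0) - if a = rev (p, m) then 1 else 0) =
      (if ((succ E)^[j] d₀).1 = p then (1 : ℝ) else 0) -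
        if ((succ E)^[j + 1] d₀).1 = p then (1 : ℝ) else 0 := fun j ↦ by
    rw [sum_comm, Function.iterate_succ_apply', ← sum_slots_sub (E := E) (fun y ↦ if y = p then (1 : ℝ) else 0)]
    refine sum_congr rfl fun a _ ↦ ?_
    rw [sum_sub_distrib, sum_ite_eq_mk, sum_ite_eq_rev_mk]
  have hQN : Qcum E d₀ u (n 0 + n 1 + n 2 + n 3) = 0 := by
    rw [Qcum, hR.sum_dP_eq_zero hlap, neg_zero]
  have hslot : ∑ m : Fin 4, ∑ j ∈ range (n 0 + n 1 + n 2 + n 3), Qcum E d₀ u (j + 1) *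
      ∑ a ∈ slots E ((succ E)^[j] d₀), ((if a = (p, m) then (1 : ℝ) else 0) - if a = rev (p, m) then 1 else 0) =
      -∑ j ∈ (range (n 0 + n 1 + n 2 + n 3)).filter (fun j ↦ ((succ E)^[j] d₀).1 = p),
        dP u ((succ E)^[j] d₀) := by
    rw [sum_comm]
    simp_rw [← mul_sum, hseg, mul_sub, sum_sub_distrib]
    have hshift := sum_range_succ_shift
      (fun l ↦ Qcum E d₀ u l * if ((succ E)^[l] d₀).1 = p then (1 : ℝ) else 0)
      (N := n 0 + n 1 + n 2 + n 3) (by rw [hQN, Qcum_zero, zero_mul, zero_mul])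
    rw [hshift, ← sum_sub_distrib, sum_filter, ← sum_neg_distrib]
    refine sum_congr rfl fun j _ ↦ ?_
    rw [Qcum_succ]
    split_ifs <;> ring
  unfold zeta
  rw [sum_sub_distrib, hcur, hslot]
  have := hlap p
  unfold lap at this
  linarith

/-- **The winding potential of the completed cycle** vanishes on the exterior square of every dart
of the boundary cycle: it is constant along the cycle (`rsq_succ`: consecutive exterior squares are
separated by the missing edge of the new dart, across which the cycle vanishes) and zero at the
West dart of a leftmost vertex (left of the support). [folklore] -/
theorem IsRect.exists_conjugate (hR : IsRect E d₀ n) (hlap : ∀ x, lap E d₀ n u x = 0) :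
    ∃ κ : Site 2 → ℝ, (∀ b, κ (lsq b) - κ (rsq b) = zeta E d₀ n u b) ∧
      ∀ i, κ (quad ((succ E)^[i] d₀).1 ((succ E)^[i] d₀).2) = 0 := by
  classical
  have hne : (verts E).Nonempty := ⟨d₀.1, hR.isExtDart.1⟩
  obtain ⟨xL, hxL, hLmin⟩ := exists_min_image (verts E) (fun x ↦ x 0) hne
  obtain ⟨xB, hxB, hBmin⟩ := exists_min_image (verts E) (fun x ↦ x 1) hne
  obtain ⟨κ, hκ, hκ0⟩ := exists_wind (zeta E d₀ n u) (xB 1) (xL 0) zeta_rev (hR.sum_zeta_eq_zero hlap)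
    fun b hb ↦ by
      have hv := fst_mem_verts_of_aedge_mem (aedge_mem_of_zeta_ne_zero hb)
      exact ⟨hBmin _ hv, hLmin _ hv⟩
  refine ⟨κ, hκ, ?_⟩
  -- constancy along the cycle
  have hstep : ∀ i, κ (quad ((succ E)^[i + 1] d₀).1 ((succ E)^[i + 1] d₀).2) =
      κ (quad ((succ E)^[i] d₀).1 ((succ E)^[i] d₀).2) := fun i ↦ by
    have h := hκ ((succ E)^[i + 1] d₀)
    rw [Function.iterate_succ_apply'] at h ⊢
    rw [rsq_succ] at h
    have hz : zeta E d₀ n u (succ E ((succ E)^[i] d₀)) = 0 := by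
      by_contra hne'
      exact (hR.isExtDart_iterate (i + 1)).2
        (by rw [Function.iterate_succ_apply']; exact aedge_mem_of_zeta_ne_zero hne')
    rw [hz, sub_eq_zero] at h
    exact h
  have hconst : ∀ i, κ (quad ((succ E)^[i] d₀).1 ((succ E)^[i] d₀).2) = κ (quad d₀.1 d₀.2) := by
    intro i
    induction i with
    | zero => rfl
    | succ i ih => rw [hstep, ih]
  -- the West dart of the leftmost vertex
  have hdart : IsExtDart E (xL, 2) := by
    refine ⟨hxL, fun h ↦ ?_⟩
    have := hLmin _ (mem_verts_of_mem h)
    simp [Pi.add_apply] at this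
  obtain ⟨i₀, -, hi₀⟩ := hR.cover _ hdart
  have h0 : κ (quad xL 2) = 0 := hκ0 _ (by simp [quad, Pi.add_apply])
  have hbase : κ (quad d₀.1 d₀.2) = 0 := by
    rw [← hconst i₀, hi₀]
    exact h0
  intro i
  rw [hconst, hbase]

end Cycle

/-! ### Faces at the corners of a vertex: combinatorics of positions -/

section Corners

variable {E : Finset (Sym2 (Site 2))} {d₀ : Site 2 × Fin 4} {n : Fin 4 → ℕ}

/-- First branch of `gen`. [folklore] -/
theorem gen_of_not_mem {p : Site 2} {m : Fin 4} (h : s(p, p + dir (m - 1)) ∉ E) :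
    gen E (p, m) = (p, m - 1) := by
  unfold gen; dsimp only; rw [if_pos h]

/-- **Consistency of generating darts around an exterior square**: if the arrow `(x, k)` of `E` has
an exterior right square `R` and the previous side `x, x + e_{k+3}` of `R` is present, then the
arrow `x + e_{k+3} → x` (which also has `R` on its right) has the same generating dart. [folklore] -/
theorem gen_rev_prev_eq_gen {x : Site 2} {k : Fin 4} (hb : aedge (x, k) ∈ E)
    (hprev : s(x, x + dir (k + 3)) ∈ E) (hF : ¬ InF E (rsq (x, k))) :
    gen E (rev (x, k + 3)) = gen E (x, k) := by
  have k1 : ∀ k : Fin 4, k + 3 + 2 = k + 1 := by decide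
  have k2 : ∀ k : Fin 4, k + 1 - 1 = k := by decide
  have k3 : ∀ k : Fin 4, k - 1 = k + 3 := by decide
  have k4 : ∀ k : Fin 4, k + 1 + 1 = k + 2 := by decide
  rw [aedge_mk] at hb
  rw [rsq_mk] at hF
  rw [rev_mk, k1]
  unfold gen
  dsimp only
  rw [k2, k3, if_neg (not_not.2 hprev)]
  by_cases h2 : s(x + dir (k + 3), x + dir (k + 3) + dir k) ∈ E
  · rw [if_neg (not_not.2 h2), if_neg (not_not.2 h2)]
    by_cases h3 : s(x + dir (k + 3) + dir k, x + dir (k + 3) + dir k + dir (k + 1)) ∈ E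
    · exact absurd (inF_quad_add_three hb (by rwa [k3]) (by rwa [k3]) (by rwa [k3])) hF
    · rw [if_pos h3]
  · rw [if_pos h2, if_pos h2]

/-- **The segment ends where the next right turn is missing**: if `a` is on the segment of `d` and
the edge from the endpoint of `a` in direction `a.2 - 1` is missing, then `succ E d` is the dart
there. [folklore] -/
theorem succ_eq_of_mem_slots_of_not_mem {d a : Site 2 × Fin 4} (ha : a ∈ slots E d)
    (hmiss : s(a.1 + dir a.2, a.1 + dir a.2 + dir (a.2 - 1)) ∉ E) :
    succ E d = (a.1 + dir a.2, a.2 - 1) := by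
  have k1 : ∀ k : Fin 4, k + 1 - 1 = k := by decide
  have k2 : ∀ k : Fin 4, k - 1 - 1 = k - 2 := by decide
  rcases mem_slots_iff.1 ha with ⟨h1, rfl⟩ | ⟨h1, h2, rfl⟩ | ⟨h1, h2, h3, rfl⟩
  · dsimp only at hmiss ⊢
    rw [k1] at hmiss ⊢
    unfold DiscreteRect.succ; dsimp only
    rw [if_neg (not_not.2 h1), if_pos hmiss]
  · dsimp only at hmiss ⊢
    unfold DiscreteRect.succ; dsimp only
    rw [if_neg (not_not.2 h1), if_neg (not_not.2 h2), if_pos hmiss]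
  · dsimp only at hmiss ⊢
    rw [k2] at hmiss ⊢
    unfold DiscreteRect.succ; dsimp only
    rw [if_neg (not_not.2 h1), if_neg (not_not.2 h2), if_neg (not_not.2 h3)]

/-- **The index of a dart on the boundary cycle.** [folklore] -/
def IsRect.idx (_hR : IsRect E d₀ n) (d : Site 2 × Fin 4) : ℕ :=
  by classical exact if h : ∃ i < n 0 + n 1 + n 2 + n 3, (succ E)^[i] d₀ = d then Nat.find h else 0

/-- The index of an external dart points at it. [folklore] -/
theorem IsRect.idx_spec (hR : IsRect E d₀ n) {d : Site 2 × Fin 4} (hd : IsExtDart E d) :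
    hR.idx d < n 0 + n 1 + n 2 + n 3 ∧ (succ E)^[hR.idx d] d₀ = d := by
  classical
  have h : ∃ i < n 0 + n 1 + n 2 + n 3, (succ E)^[i] d₀ = d := hR.cover d hd
  unfold IsRect.idx
  rw [dif_pos h]
  exact Nat.find_spec h

/-- The index of the `i`-th dart is `i`. [folklore] -/
theorem IsRect.idx_iterate (hR : IsRect E d₀ n) {i : ℕ} (hi : i < n 0 + n 1 + n 2 + n 3) :
    hR.idx ((succ E)^[i] d₀) = i := by
  have h := hR.idx_spec (hR.isExtDart_iterate i)
  exact hR.injOn _ _ h.1 hi h.2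

/-- The index is always in range (when the cycle is nonempty). [folklore] -/
theorem IsRect.idx_lt (hR : IsRect E d₀ n) (d : Site 2 × Fin 4) : hR.idx d < n 0 + n 1 + n 2 + n 3 := by
  classical
  unfold IsRect.idx
  split_ifs with h
  · exact (Nat.find_spec h).1
  · have := hR.pos 0; omega

/-- **Which positions walk a given arrow**: the weighted count `Σ_j c_j [b ∈ σ_j]` is `c` at the
index of the generating dart if the right square of `b` is exterior, and `0` otherwise. [folklore] -/
theorem IsRect.sum_ite_mem_slots (hR : IsRect E d₀ n) (c : ℕ → ℝ) {b : Site 2 × Fin 4}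
    (hb : aedge b ∈ E) :
    ∑ j ∈ range (n 0 + n 1 + n 2 + n 3), (if b ∈ slots E ((succ E)^[j] d₀) then c j else 0) =
      if InF E (rsq b) then 0 else c (hR.idx (gen E b)) := by
  split_ifs with hF
  · refine sum_eq_zero fun j _ ↦ ?_
    rw [if_neg]
    intro hmem
    rw [rsq_of_mem_slots hmem] at hF
    exact not_inF_quad (hR.isExtDart_iterate j).2 hF
  · obtain ⟨hj, hD⟩ := hR.idx_spec (isExtDart_gen hb hF)
    rw [← sum_ite_eq_of_mem' (range (n 0 + n 1 + n 2 + n 3)) (hR.idx (gen E b)) c (mem_range.2 hj)]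
    refine sum_congr rfl fun j hj' ↦ ?_
    congr 1
    refine propext ⟨fun hmem ↦ ?_, fun h ↦ ?_⟩
    · have h1 := gen_eq_of_mem_slots (hR.isExtDart_iterate j).2 hmem
      rw [h1, hR.idx_iterate (mem_range.1 hj')]
    · rw [h, hD]
      exact mem_slots_gen hb

/-- **The completed cycle on an arrow of `E`**, in terms of generating darts. [folklore] -/
theorem IsRect.zeta_eq (hR : IsRect E d₀ n) (u : Site 2 ⊕ (Site 2 × Fin 4) → ℝ)
    {b : Site 2 × Fin 4} (hb : aedge b ∈ E) :
    zeta E d₀ n u b = -dA u b -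
      (if InF E (rsq b) then 0 else Qcum E d₀ u (hR.idx (gen E b) + 1)) +
      (if InF E (lsq b) then 0 else Qcum E d₀ u (hR.idx (gen E (rev b)) + 1)) := by
  unfold zeta cur
  rw [if_pos hb]
  have h1 : ∀ j, ∑ a ∈ slots E ((succ E)^[j] d₀), ((if a = b then (1 : ℝ) else 0) - if a = rev b then 1 else 0) =
      (if b ∈ slots E ((succ E)^[j] d₀) then (1 : ℝ) else 0) -
        if rev b ∈ slots E ((succ E)^[j] d₀) then (1 : ℝ) else 0 := fun j ↦ by
    rw [sum_sub_distrib, sum_ite_eq' , sum_ite_eq']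
  simp_rw [h1, mul_sub, sum_sub_distrib, mul_ite, mul_one, mul_zero]
  rw [hR.sum_ite_mem_slots _ hb, hR.sum_ite_mem_slots _ (by rwa [aedge_rev]), rsq_rev]
  ring

end Corners

/-! ### The harmonic conjugate at the corners of the vertices -/

section Potential

variable {E : Finset (Sym2 (Site 2))} {d₀ : Site 2 × Fin 4} {n : Fin 4 → ℕ}
variable {u : Site 2 ⊕ (Site 2 × Fin 4) → ℝ} {κ : Site 2 → ℝ}

/-- First branch of `succ` (the lemma `succ_of_not_mem` of `DiscreteRectBoundaryLoop`, restated to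
keep the imports of this file small). [folklore] -/
theorem succ_mk_of_not_mem {x : Site 2} {k : Fin 4} (h : s(x, x + dir (k + 1)) ∉ E) :
    succ E (x, k) = (x, k + 1) := by
  unfold DiscreteRect.succ; dsimp only; rw [if_pos h]

/-- The right square of a missing arrow is not a face. [folklore] -/
theorem not_inF_quad_add_three {x : Site 2} {k : Fin 4} (h : s(x, x + dir k) ∉ E) :
    ¬ InF E (quad x (k + 3)) := by
  refine not_inF_of_not_mem (k + 2) ?_
  have k2 : ∀ m : Fin 4, m + 3 + 3 = m + 2 := by decide
  have k0 : ∀ m : Fin 4, m + 3 + 1 = m := by decide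
  have c2 : corner (quad x (k + 3)) (k + 2) = x + dir k := by
    have := corner_quad_add_three x (k + 3); rwa [k2, k0] at this
  rw [c2, dir_add_two, Sym2.eq_swap, ← sub_eq_add_neg, add_sub_cancel_right]
  exact h

/-- **The value of the `j`-th boundary position**: minus the cumulative pendant current through
the positions `0, …, j`. [folklore] -/
def psi (E : Finset (Sym2 (Site 2))) (d₀ : Site 2 × Fin 4) (u : Site 2 ⊕ (Site 2 × Fin 4) → ℝ)
    (j : ℕ) : ℝ :=
  -Qcum E d₀ u (j + 1)

/-- **The harmonic conjugate read at a corner** `(x, k)` (the quadrant `quad x k` at the vertex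
`x`): the face potential if the quadrant is a face, and otherwise the value of the boundary
position whose segment passes through that corner — the position walking the arrow `x + e_k → x`
if the edge `x, x + e_k` is present, the dart `(x, k)` itself if it is missing. [folklore] -/
def IsRect.phi (hR : IsRect E d₀ n) (κ : Site 2 → ℝ) (u : Site 2 ⊕ (Site 2 × Fin 4) → ℝ)
    (c : Site 2 × Fin 4) : ℝ :=
  if InF E (quad c.1 c.2) then κ (quad c.1 c.2)
  else if aedge c ∈ E then psi E d₀ u (hR.idx (gen E (rev c))) else psi E d₀ u (hR.idx c)

/-- The conjugate vanishes on the exterior right square of an arrow of `E`. [folklore] -/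
theorem IsRect.kappa_rsq_eq_zero (hR : IsRect E d₀ n)
    (hκ0 : ∀ i, κ (quad ((succ E)^[i] d₀).1 ((succ E)^[i] d₀).2) = 0) {b : Site 2 × Fin 4}
    (hb : aedge b ∈ E) (hF : ¬ InF E (rsq b)) : κ (rsq b) = 0 := by
  obtain ⟨-, hD⟩ := hR.idx_spec (isExtDart_gen hb hF)
  rw [rsq_of_mem_slots (mem_slots_gen hb), ← hD]
  exact hκ0 _

/-- The conjugate vanishes on the exterior left square of an arrow of `E`. [folklore] -/
theorem IsRect.kappa_lsq_eq_zero (hR : IsRect E d₀ n)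
    (hκ0 : ∀ i, κ (quad ((succ E)^[i] d₀).1 ((succ E)^[i] d₀).2) = 0) {b : Site 2 × Fin 4}
    (hb : aedge b ∈ E) (hF : ¬ InF E (lsq b)) : κ (lsq b) = 0 := by
  rw [← rsq_rev]
  exact hR.kappa_rsq_eq_zero hκ0 (by rwa [aedge_rev]) (by rwa [rsq_rev])

/-- **The jump of the conjugate across an arrow of `E` is its current**, whatever the nature
(face or boundary position) of the two sides. [folklore] -/
theorem IsRect.valL_sub_valR (hR : IsRect E d₀ n)
    (hκ : ∀ b, κ (lsq b) - κ (rsq b) = zeta E d₀ n u b)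
    (hκ0 : ∀ i, κ (quad ((succ E)^[i] d₀).1 ((succ E)^[i] d₀).2) = 0) {b : Site 2 × Fin 4}
    (hb : aedge b ∈ E) :
    (if InF E (lsq b) then κ (lsq b) else psi E d₀ u (hR.idx (gen E (rev b)))) -
        (if InF E (rsq b) then κ (rsq b) else psi E d₀ u (hR.idx (gen E b))) = -dA u b := by
  have h := hκ b
  rw [hR.zeta_eq u hb] at h
  unfold psi
  by_cases hL : InF E (lsq b) <;> by_cases hR' : InF E (rsq b)
  · rw [if_pos hL, if_pos hR'] at h ⊢; linarith
  · rw [if_pos hL, if_neg hR'] at h ⊢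
    have := hR.kappa_rsq_eq_zero hκ0 hb hR'; linarith
  · rw [if_neg hL, if_pos hR'] at h ⊢
    have := hR.kappa_lsq_eq_zero hκ0 hb hL; linarith
  · rw [if_neg hL, if_neg hR'] at h ⊢
    have h1 := hR.kappa_rsq_eq_zero hκ0 hb hR'
    have h2 := hR.kappa_lsq_eq_zero hκ0 hb hL; linarith

/-- **Corner step across a present edge**: the values at the corners `(x, k)` and `(x, k + 3)`
(left and right of the arrow `(x, k)`) differ by minus the current of the arrow. [folklore] -/
theorem IsRect.phi_sub_phi_of_mem (hR : IsRect E d₀ n)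
    (hκ : ∀ b, κ (lsq b) - κ (rsq b) = zeta E d₀ n u b)
    (hκ0 : ∀ i, κ (quad ((succ E)^[i] d₀).1 ((succ E)^[i] d₀).2) = 0) {x : Site 2} {k : Fin 4}
    (hb : aedge (x, k) ∈ E) :
    hR.phi κ u (x, k) - hR.phi κ u (x, k + 3) = -dA u (x, k) := by
  have h := hR.valL_sub_valR hκ hκ0 hb
  rw [lsq_mk, rsq_mk] at h
  have k3 : ∀ k : Fin 4, k - 1 = k + 3 := by decide
  have e1 : hR.phi κ u (x, k) = if InF E (quad x k) then κ (quad x k)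
      else psi E d₀ u (hR.idx (gen E (rev (x, k)))) := by
    unfold IsRect.phi; dsimp only; rw [if_pos hb]
  have e2 : hR.phi κ u (x, k + 3) = if InF E (quad x (k + 3)) then κ (quad x (k + 3))
      else psi E d₀ u (hR.idx (gen E (x, k))) := by
    unfold IsRect.phi; dsimp only
    by_cases hF : InF E (quad x (k + 3))
    · rw [if_pos hF, if_pos hF]
    · rw [if_neg hF, if_neg hF]
      by_cases hprev : aedge (x, k + 3) ∈ E
      · rw [if_pos hprev, gen_rev_prev_eq_gen hb hprev (by rwa [rsq_mk])]
      · rw [if_neg hprev, gen_of_not_mem (by rw [k3]; exact hprev), k3]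
  rw [e1, e2]
  exact h

/-- **Position step**: the values of consecutive boundary positions differ by the pendant current
of the later one (with the wrap-around at `N`, using that the total pendant current vanishes).
[folklore] -/
theorem IsRect.psi_idx_sub_psi (hR : IsRect E d₀ n) (hlap : ∀ x, lap E d₀ n u x = 0) {j : ℕ}
    (hj : j < n 0 + n 1 + n 2 + n 3) {d : Site 2 × Fin 4} (hd : succ E ((succ E)^[j] d₀) = d) :
    psi E d₀ u (hR.idx d) - psi E d₀ u j = dP u d := by
  subst hd
  unfold psi
  rw [← Function.iterate_succ_apply' (succ E) j d₀]
  by_cases h : j + 1 < n 0 + n 1 + n 2 + n 3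
  · rw [hR.idx_iterate h, Qcum_succ (j + 1)]
    ring
  · have hN : j + 1 = n 0 + n 1 + n 2 + n 3 := by omega
    have hper : (succ E)^[j + 1] d₀ = d₀ := by rw [hN]; exact hR.periodic
    have h0 : hR.idx d₀ = 0 := hR.idx_iterate (i := 0) (by omega)
    have hQN : Qcum E d₀ u (n 0 + n 1 + n 2 + n 3) = 0 := by
      unfold Qcum; rw [hR.sum_dP_eq_zero hlap, neg_zero]
    rw [hper, h0, Qcum_succ 0, Qcum_zero, hN, hQN, Function.iterate_zero_apply]
    ring

/-- **Corner step across a missing edge**: the values at the corners `(x, k)` and `(x, k + 3)` on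
the two sides of the dart `(x, k)` differ by its pendant current. [folklore] -/
theorem IsRect.phi_sub_phi_of_not_mem (hR : IsRect E d₀ n) (hlap : ∀ x, lap E d₀ n u x = 0)
    {x : Site 2} {k : Fin 4} (hx : x ∈ verts E) (hb : aedge (x, k) ∉ E) :
    hR.phi κ u (x, k) - hR.phi κ u (x, k + 3) = dP u (x, k) := by
  have hF1 : ¬ InF E (quad x k) := not_inF_quad hb
  have hF2 : ¬ InF E (quad x (k + 3)) := not_inF_quad_add_three hb
  have k0 : ∀ k : Fin 4, k + 3 + 1 = k := by decide
  have e1 : hR.phi κ u (x, k) = psi E d₀ u (hR.idx (x, k)) := by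
    unfold IsRect.phi; dsimp only; rw [if_neg hF1, if_neg hb]
  obtain ⟨j, hj, hsucc, e2⟩ : ∃ j < n 0 + n 1 + n 2 + n 3, succ E ((succ E)^[j] d₀) = (x, k) ∧
      hR.phi κ u (x, k + 3) = psi E d₀ u j := by
    by_cases hprev : aedge (x, k + 3) ∈ E
    · -- the position walking `x + e_{k+3} → x` ends its segment at the dart `(x, k)`
      have hcE : aedge (rev (x, k + 3)) ∈ E := by rwa [aedge_rev]
      have hcF : ¬ InF E (rsq (rev (x, k + 3))) := by rwa [rsq_rev, lsq_mk]
      obtain ⟨hj, hD⟩ := hR.idx_spec (isExtDart_gen hcE hcF)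
      refine ⟨_, hj, ?_, ?_⟩
      · rw [hD]
        have k1 : ∀ k : Fin 4, k + 3 + 2 - 1 = k := by decide
        have hx0 : x + dir (k + 3) + dir (k + 3 + 2) = x := by
          rw [dir_add_two]; abel
        have := succ_eq_of_mem_slots_of_not_mem (mem_slots_gen hcE) (by
          rw [rev_mk]; dsimp only; rw [hx0, k1]; exact hb)
        rw [this, rev_mk]; dsimp only; rw [hx0, k1]
      · unfold IsRect.phi; dsimp only; rw [if_neg hF2, if_pos hprev]
    · have hd' : IsExtDart E (x, k + 3) := ⟨hx, hprev⟩
      obtain ⟨hj, hD⟩ := hR.idx_spec hd'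
      refine ⟨_, hj, ?_, ?_⟩
      · rw [hD, succ_mk_of_not_mem (by rw [k0]; exact hb), k0]
      · unfold IsRect.phi; dsimp only; rw [if_neg hF2, if_neg hprev]
  rw [e1, e2]
  exact hR.psi_idx_sub_psi hlap hj hsucc

/-- **No jump along an edge**: the two corners on the left of an arrow of `E`, at its two ends,
carry the same value. [folklore] -/
theorem IsRect.phi_add_dir (hR : IsRect E d₀ n) {x : Site 2} {k : Fin 4} (hb : aedge (x, k) ∈ E) :
    hR.phi κ u (x + dir k, k + 1) = hR.phi κ u (x, k) := by
  have k5 : ∀ k : Fin 4, k + 2 + 3 = k + 1 := by decide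
  have k21 : ∀ k : Fin 4, k + 2 - 1 = k + 1 := by decide
  unfold IsRect.phi; dsimp only
  rw [quad_add_dir, if_pos hb]
  by_cases hF : InF E (quad x k)
  · rw [if_pos hF, if_pos hF]
  · rw [if_neg hF, if_neg hF]
    by_cases h2 : aedge (x + dir k, k + 1) ∈ E
    · rw [if_pos h2]
      have hb' : aedge (rev (x, k)) ∈ E := by rwa [aedge_rev]
      have hF' : ¬ InF E (rsq (rev (x, k))) := by rwa [rsq_rev, lsq_mk]
      rw [rev_mk] at hb' hF'
      have := gen_rev_prev_eq_gen hb' (by rw [k5]; exact h2) hF'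
      rw [k5] at this
      rw [this, rev_mk]
    · rw [if_neg h2, rev_mk, gen_of_not_mem (by rw [k21]; exact h2), k21]

end Potential

/-! ### The test function for `(B_ext, D_ext)` and its energy -/

section Energy

variable {E : Finset (Sym2 (Site 2))} {d₀ : Site 2 × Fin 4} {n : Fin 4 → ℕ}
variable {u : Site 2 ⊕ (Site 2 × Fin 4) → ℝ} {κ : Site 2 → ℝ}

/-- **The flux through the corner step** `(x, m) → (x, m + 3)`: the current of the arrow `(x, m)`
if its edge is present, the pendant current of the dart `(x, m)` otherwise. [folklore] -/
def flux (E : Finset (Sym2 (Site 2))) (u : Site 2 ⊕ (Site 2 × Fin 4) → ℝ) (c : Site 2 × Fin 4) : ℝ :=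
  if aedge c ∈ E then |dA u c| else |dP u c|

/-- Fluxes are nonnegative. [folklore] -/
theorem flux_nonneg (c : Site 2 × Fin 4) : 0 ≤ flux E u c := by
  unfold flux; split_ifs <;> exact abs_nonneg _

/-- The square of the flux. [folklore] -/
theorem flux_sq (c : Site 2 × Fin 4) :
    flux E u c ^ 2 = if aedge c ∈ E then dA u c ^ 2 else dP u c ^ 2 := by
  unfold flux; split_ifs <;> exact sq_abs _

/-- **The total flux at a vertex.** [folklore] -/
def star (E : Finset (Sym2 (Site 2))) (u : Site 2 ⊕ (Site 2 × Fin 4) → ℝ) (x : Site 2) : ℝ :=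
  ∑ m : Fin 4, flux E u (x, m)

/-- The total flux, expanded. [folklore] -/
theorem star_eq (x : Site 2) :
    star E u x = flux E u (x, 0) + flux E u (x, 1) + flux E u (x, 2) + flux E u (x, 3) := by
  unfold star; rw [Fin.sum_univ_four]

/-- Cauchy–Schwarz for the total flux. [folklore] -/
theorem star_sq_le (x : Site 2) : star E u x ^ 2 ≤ 4 * ∑ m : Fin 4, flux E u (x, m) ^ 2 := by
  have h := sq_sum_le_card_mul_sum_sq (s := (Finset.univ : Finset (Fin 4)))
    (f := fun m ↦ flux E u (x, m))
  rw [Finset.card_univ, Fintype.card_fin] at h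
  unfold star
  exact_mod_cast h

/-- One corner step is bounded by the flux through it. [folklore] -/
theorem IsRect.abs_phi_sub_phi_le (hR : IsRect E d₀ n)
    (hκ : ∀ b, κ (lsq b) - κ (rsq b) = zeta E d₀ n u b)
    (hκ0 : ∀ i, κ (quad ((succ E)^[i] d₀).1 ((succ E)^[i] d₀).2) = 0)
    (hlap : ∀ x, lap E d₀ n u x = 0) {x : Site 2} (hx : x ∈ verts E) (m : Fin 4) :
    |hR.phi κ u (x, m) - hR.phi κ u (x, m + 3)| ≤ flux E u (x, m) := by
  unfold flux
  by_cases hb : aedge (x, m) ∈ E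
  · rw [if_pos hb, hR.phi_sub_phi_of_mem hκ hκ0 hb, abs_neg]
  · rw [if_neg hb, hR.phi_sub_phi_of_not_mem hlap hx hb]

/-- **Going round a vertex**: any two corners of a vertex differ by at most the total flux.
[folklore] -/
theorem IsRect.abs_phi_zero_sub_phi_le (hR : IsRect E d₀ n)
    (hκ : ∀ b, κ (lsq b) - κ (rsq b) = zeta E d₀ n u b)
    (hκ0 : ∀ i, κ (quad ((succ E)^[i] d₀).1 ((succ E)^[i] d₀).2) = 0)
    (hlap : ∀ x, lap E d₀ n u x = 0) {x : Site 2} (hx : x ∈ verts E) (k : Fin 4) :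
    |hR.phi κ u (x, 0) - hR.phi κ u (x, k)| ≤ star E u x := by
  have h0 := hR.abs_phi_sub_phi_le hκ hκ0 hlap hx 0
  have h3 := hR.abs_phi_sub_phi_le hκ hκ0 hlap hx 3
  have h2 := hR.abs_phi_sub_phi_le hκ hκ0 hlap hx 2
  have e0 : (0 : Fin 4) + 3 = 3 := rfl
  have e3 : (3 : Fin 4) + 3 = 2 := rfl
  have e2 : (2 : Fin 4) + 3 = 1 := rfl
  rw [e0] at h0; rw [e3] at h3; rw [e2] at h2
  have n0 := flux_nonneg (E := E) (u := u) (x, 0)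
  have n1 := flux_nonneg (E := E) (u := u) (x, 1)
  have n2 := flux_nonneg (E := E) (u := u) (x, 2)
  have n3 := flux_nonneg (E := E) (u := u) (x, 3)
  rw [star_eq]
  have hk : k = 0 ∨ k = 1 ∨ k = 2 ∨ k = 3 := by fin_cases k <;> decide
  rcases hk with rfl | rfl | rfl | rfl
  · rw [sub_self, abs_zero]; positivity
  · have t1 := abs_sub_le (hR.phi κ u (x, 0)) (hR.phi κ u (x, 3)) (hR.phi κ u (x, 1))
    have t2 := abs_sub_le (hR.phi κ u (x, 3)) (hR.phi κ u (x, 2)) (hR.phi κ u (x, 1))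
    linarith
  · have t1 := abs_sub_le (hR.phi κ u (x, 0)) (hR.phi κ u (x, 3)) (hR.phi κ u (x, 2))
    linarith
  · linarith

/-- **The test function** for `(B_ext, D_ext)`: the conjugate at the `0`-th corner of each lattice
vertex and the position values at the external vertices. [folklore] -/
def IsRect.wfun (hR : IsRect E d₀ n) (κ : Site 2 → ℝ) (u : Site 2 ⊕ (Site 2 × Fin 4) → ℝ) :
    Site 2 ⊕ (Site 2 × Fin 4) → ℝ
  | .inl x => hR.phi κ u (x, 0)
  | .inr d => psi E d₀ u (hR.idx d)

/-- Increments of the test function along the edges of `E`. [folklore] -/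
theorem IsRect.abs_dA_wfun_le (hR : IsRect E d₀ n)
    (hκ : ∀ b, κ (lsq b) - κ (rsq b) = zeta E d₀ n u b)
    (hκ0 : ∀ i, κ (quad ((succ E)^[i] d₀).1 ((succ E)^[i] d₀).2) = 0)
    (hlap : ∀ x, lap E d₀ n u x = 0) {a : Site 2 × Fin 4} (ha : aedge a ∈ E) :
    |dA (hR.wfun κ u) a| ≤ star E u a.1 + star E u (a.1 + dir a.2) := by
  obtain ⟨x, k⟩ := a
  dsimp only
  have hx : x ∈ verts E := fst_mem_verts_of_aedge_mem ha
  have hy : x + dir k ∈ verts E := mem_verts_of_mem ha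
  have h1 := hR.abs_phi_zero_sub_phi_le hκ hκ0 hlap hx k
  have h2 := hR.abs_phi_zero_sub_phi_le hκ hκ0 hlap hy (k + 1)
  have h3 := hR.phi_add_dir (κ := κ) (u := u) ha
  unfold dA IsRect.wfun
  dsimp only
  rw [h3] at h2
  have t := abs_sub_le (hR.phi κ u (x + dir k, 0)) (hR.phi κ u (x, k)) (hR.phi κ u (x, 0))
  rw [abs_sub_comm] at h1
  linarith

/-- Increments of the test function along the pendant edges. [folklore] -/
theorem IsRect.abs_dP_wfun_le (hR : IsRect E d₀ n)
    (hκ : ∀ b, κ (lsq b) - κ (rsq b) = zeta E d₀ n u b)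
    (hκ0 : ∀ i, κ (quad ((succ E)^[i] d₀).1 ((succ E)^[i] d₀).2) = 0)
    (hlap : ∀ x, lap E d₀ n u x = 0) (i : ℕ) :
    |dP (hR.wfun κ u) ((succ E)^[i] d₀)| ≤ star E u ((succ E)^[i] d₀).1 := by
  have hd := hR.isExtDart_iterate i
  set d := (succ E)^[i] d₀ with hd'
  obtain ⟨x, k⟩ := d
  have hb : aedge (x, k) ∉ E := hd.2
  have hF : ¬ InF E (quad x k) := not_inF_quad hb
  have e : hR.phi κ u (x, k) = psi E d₀ u (hR.idx (x, k)) := by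
    unfold IsRect.phi; dsimp only; rw [if_neg hF, if_neg hb]
  have h1 := hR.abs_phi_zero_sub_phi_le hκ hκ0 hlap hd.1 k
  unfold dP IsRect.wfun
  dsimp only
  rwa [← e]

/-- Sums over the sources of arrows against sums over vertices. [folklore] -/
theorem sum_arrows_le_four_mul {g : Site 2 → ℝ} (hg : ∀ x, 0 ≤ g x) :
    ∑ a ∈ arrows E, g a.1 ≤ 4 * ∑ x ∈ verts E, g x := by
  calc ∑ a ∈ arrows E, g a.1 ≤ ∑ a ∈ verts E ×ˢ (Finset.univ : Finset (Fin 4)), g a.1 :=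
        sum_le_sum_of_subset_of_nonneg (filter_subset _ _) fun _ _ _ ↦ hg _
    _ = 4 * ∑ x ∈ verts E, g x := by
        rw [sum_product, mul_sum]
        refine sum_congr rfl fun x _ ↦ ?_
        simp [sum_const, Finset.card_univ, Fintype.card_fin]

/-- Sums over the darts of the boundary cycle against sums over vertices. [folklore] -/
theorem IsRect.sum_range_le_four_mul (hR : IsRect E d₀ n) {g : Site 2 → ℝ} (hg : ∀ x, 0 ≤ g x) :
    ∑ i ∈ range (n 0 + n 1 + n 2 + n 3), g ((succ E)^[i] d₀).1 ≤ 4 * ∑ x ∈ verts E, g x := by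
  classical
  have hinj : Set.InjOn (fun i ↦ (succ E)^[i] d₀) ↑(range (n 0 + n 1 + n 2 + n 3)) :=
    fun i hi j hj h ↦ hR.injOn i j (mem_range.1 hi) (mem_range.1 hj) h
  rw [← sum_image (g := fun i ↦ (succ E)^[i] d₀) (f := fun d ↦ g d.1) hinj]
  calc ∑ d ∈ (range (n 0 + n 1 + n 2 + n 3)).image (fun i ↦ (succ E)^[i] d₀), g d.1
      ≤ ∑ a ∈ verts E ×ˢ (Finset.univ : Finset (Fin 4)), g a.1 := by
        refine sum_le_sum_of_subset_of_nonneg (fun d hd ↦ ?_) fun _ _ _ ↦ hg _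
        obtain ⟨i, -, rfl⟩ := mem_image.1 hd
        exact mem_product.2 ⟨(hR.isExtDart_iterate i).1, mem_univ _⟩
    _ = 4 * ∑ x ∈ verts E, g x := by
        rw [sum_product, mul_sum]
        refine sum_congr rfl fun x _ ↦ ?_
        simp [sum_const, Finset.card_univ, Fintype.card_fin]

/-- **The fluxes are the currents**: summing the squared fluxes over all corners gives the squared
currents of the arrows and of the pendant edges. [folklore] -/
theorem IsRect.sum_flux_sq_eq (hR : IsRect E d₀ n) (u : Site 2 ⊕ (Site 2 × Fin 4) → ℝ) :
    ∑ x ∈ verts E, ∑ m : Fin 4, flux E u (x, m) ^ 2 =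
      ∑ a ∈ arrows E, dA u a ^ 2 + ∑ i ∈ range (n 0 + n 1 + n 2 + n 3), dP u ((succ E)^[i] d₀) ^ 2 := by
  classical
  rw [← sum_product (s := verts E) (t := (Finset.univ : Finset (Fin 4))) (f := fun c ↦ flux E u c ^ 2)]
  simp_rw [flux_sq]
  rw [sum_ite]
  congr 1
  symm
  refine sum_nbij (fun i ↦ (succ E)^[i] d₀) (fun i _ ↦ ?_) (fun i hi j hj h ↦ ?_) (fun d hd ↦ ?_)
    (fun _ _ ↦ rfl)
  · have h := hR.isExtDart_iterate i
    exact mem_filter.2 ⟨mem_product.2 ⟨h.1, mem_univ _⟩, h.2⟩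
  · exact hR.injOn i j (mem_range.1 hi) (mem_range.1 hj) h
  · obtain ⟨h1, h2⟩ := mem_filter.1 (Finset.mem_coe.1 hd)
    obtain ⟨i, hi, rfl⟩ := hR.cover d ⟨(mem_product.1 h1).1, h2⟩
    exact ⟨i, Finset.mem_coe.2 (mem_range.2 hi), rfl⟩

/-- **Energy of the test function**: `ℰ(w) ≤ 96 ℰ(u)`. [folklore] -/
theorem IsRect.dirE_wfun_le (hR : IsRect E d₀ n)
    (hκ : ∀ b, κ (lsq b) - κ (rsq b) = zeta E d₀ n u b)
    (hκ0 : ∀ i, κ (quad ((succ E)^[i] d₀).1 ((succ E)^[i] d₀).2) = 0)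
    (hlap : ∀ x, lap E d₀ n u x = 0) :
    dirE E d₀ n (hR.wfun κ u) ≤ 96 * dirE E d₀ n u := by
  have hs0 : ∀ x, 0 ≤ star E u x := fun x ↦ sum_nonneg fun m _ ↦ flux_nonneg _
  -- edge increments
  have h1 : ∑ a ∈ arrows E, dA (hR.wfun κ u) a ^ 2 ≤ 4 * ∑ a ∈ arrows E, star E u a.1 ^ 2 := by
    have h : ∀ a ∈ arrows E, dA (hR.wfun κ u) a ^ 2 ≤
        2 * star E u a.1 ^ 2 + 2 * star E u (rev a).1 ^ 2 := fun a ha ↦ by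
      have hb := hR.abs_dA_wfun_le hκ hκ0 hlap (mem_arrows.1 ha)
      have := sq_le_sq' (abs_le.1 hb).1 (abs_le.1 hb).2
      rw [show (rev a).1 = a.1 + dir a.2 from rfl]
      nlinarith [hs0 a.1, hs0 (a.1 + dir a.2), sq_nonneg (star E u a.1 - star E u (a.1 + dir a.2))]
    refine (sum_le_sum h).trans_eq ?_
    rw [sum_add_distrib, ← mul_sum, ← mul_sum,
      sum_arrows_rev (E := E) (g := fun a ↦ star E u a.1 ^ 2)]
    ring
  -- pendant increments
  have h2 : ∑ i ∈ range (n 0 + n 1 + n 2 + n 3), dP (hR.wfun κ u) ((succ E)^[i] d₀) ^ 2 ≤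
      ∑ i ∈ range (n 0 + n 1 + n 2 + n 3), star E u ((succ E)^[i] d₀).1 ^ 2 :=
    sum_le_sum fun i _ ↦ by
      have hb := hR.abs_dP_wfun_le hκ hκ0 hlap i
      exact sq_le_sq' (abs_le.1 hb).1 (abs_le.1 hb).2
  have h3 := sum_arrows_le_four_mul (E := E) (g := fun x ↦ star E u x ^ 2) fun x ↦ sq_nonneg _
  have h4 := hR.sum_range_le_four_mul (g := fun x ↦ star E u x ^ 2) fun x ↦ sq_nonneg _
  have h5 : ∑ x ∈ verts E, star E u x ^ 2 ≤ 4 * (∑ a ∈ arrows E, dA u a ^ 2 +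
      ∑ i ∈ range (n 0 + n 1 + n 2 + n 3), dP u ((succ E)^[i] d₀) ^ 2) := by
    rw [← hR.sum_flux_sq_eq u, mul_sum]
    exact sum_le_sum fun x _ ↦ star_sq_le x
  rw [hR.dirE_eq_arrows, hR.dirE_eq_arrows]
  have h6 : 0 ≤ ∑ a ∈ arrows E, dA u a ^ 2 := sum_nonneg fun _ _ ↦ sq_nonneg _
  have h7 : 0 ≤ ∑ i ∈ range (n 0 + n 1 + n 2 + n 3), dP u ((succ E)^[i] d₀) ^ 2 :=
    sum_nonneg fun _ _ ↦ sq_nonneg _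
  linarith

/-- Scaling of the real energy. [folklore] -/
theorem dirE_const_mul (c : ℝ) (f : Site 2 ⊕ (Site 2 × Fin 4) → ℝ) :
    dirE E d₀ n (fun v ↦ c * f v) = c ^ 2 * dirE E d₀ n f := by
  unfold dirE
  rw [mul_add, mul_sum, mul_sum]
  congr 1
  · refine sum_congr rfl fun e _ ↦ ?_
    induction e using Sym2.ind with
    | h x y => simp only [sqIncr_mk, Function.comp_apply]; ring
  · refine sum_congr rfl fun i _ ↦ ?_
    simp only [dP]; ring

end Energy

/-! ### The lower bound -/

section LowerBound

variable {E : Finset (Sym2 (Site 2))} {d₀ : Site 2 × Fin 4} {n : Fin 4 → ℕ}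
variable {u : Site 2 ⊕ (Site 2 × Fin 4) → ℝ}

/-- **Boundary values on `B_ext`**: the positions of the arc `B` all carry the total current out
of `A`. [folklore] -/
theorem psi_eq_of_B (hB : ∀ i, n 0 ≤ i → i < n 0 + n 1 → dP u ((succ E)^[i] d₀) = 0) {i : ℕ}
    (h1 : n 0 ≤ i) (h2 : i < n 0 + n 1) :
    psi E d₀ u i = ∑ l ∈ range (n 0), dP u ((succ E)^[l] d₀) := by
  unfold psi Qcum
  rw [neg_neg, ← sum_range_add_sum_Ico _ (show n 0 ≤ i + 1 by omega), add_eq_left]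
  exact sum_eq_zero fun l hl ↦ by
    rw [Finset.mem_Ico] at hl
    exact hB l hl.1 (by omega)

/-- **Boundary values on `D_ext`**: the positions of the arc `D` carry no cumulative current.
[folklore] -/
theorem IsRect.psi_eq_zero_of_D (hR : IsRect E d₀ n) (hlap : ∀ x, lap E d₀ n u x = 0)
    (hD : ∀ i, n 0 + n 1 + n 2 ≤ i → i < n 0 + n 1 + n 2 + n 3 → dP u ((succ E)^[i] d₀) = 0)
    {i : ℕ} (h1 : n 0 + n 1 + n 2 ≤ i) (h2 : i < n 0 + n 1 + n 2 + n 3) : psi E d₀ u i = 0 := by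
  unfold psi Qcum
  rw [neg_neg]
  have h := sum_range_add_sum_Ico (fun l ↦ dP u ((succ E)^[l] d₀))
    (show i + 1 ≤ n 0 + n 1 + n 2 + n 3 by omega)
  rw [hR.sum_dP_eq_zero hlap] at h
  have h0 : ∑ l ∈ Ico (i + 1) (n 0 + n 1 + n 2 + n 3), dP u ((succ E)^[l] d₀) = 0 :=
    sum_eq_zero fun l hl ↦ by
      rw [Finset.mem_Ico] at hl
      exact hD l (by omega) hl.2
  linarith

/-- **Lower bound of the self-duality** (Chelkak–Duminil-Copin–Hongler 2016, §3.3, third displayed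
property, lower half): for every discrete topological rectangle,
`ℓ_Ω̄[(a_ext b_ext),(c_ext d_ext)] · ℓ_Ω̄[(b_ext c_ext),(d_ext a_ext)] ≥ 1/96`. The printed source
derives this from the comparison with continuous extremal lengths (Chelkak 2016, Prop. 6.2 and
Cor. 6.3); here it is proved by the discrete harmonic-conjugate argument of this file, with a
worse but absolute constant.
[cite: ChelkakDuminilCopinHongler2016, §3.3 (self-duality of discrete extremal lengths)] -/
theorem IsRect.le_extResistance_mul_extResistance (hR : IsRect E d₀ n) :
    ENNReal.ofReal (1 / 96) ≤ extResistance E d₀ n 0 2 * extResistance E d₀ n 1 3 := by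
  classical
  obtain ⟨hl0, hl1, hl2, hl3⟩ := lo_eq n
  -- the minimiser for `(A_ext, C_ext)` and its harmonicity
  obtain ⟨u, huA, huC, hmin⟩ := hR.exists_dirE_min
  have hlap : ∀ x, lap E d₀ n u x = 0 := hR.lap_eq_zero_of_min huA huC hmin
  have hB : ∀ i, n 0 ≤ i → i < n 0 + n 1 → dP u ((succ E)^[i] d₀) = 0 := fun i h1 h2 ↦
    hR.dP_eq_zero_of_min huA huC hmin (Or.inl ⟨h1, h2⟩)
  have hD : ∀ i, n 0 + n 1 + n 2 ≤ i → i < n 0 + n 1 + n 2 + n 3 →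
      dP u ((succ E)^[i] d₀) = 0 := fun i h1 h2 ↦
    hR.dP_eq_zero_of_min huA huC hmin (Or.inr ⟨h1, h2⟩)
  have huA' : ∀ i < n 0, u (.inr ((succ E)^[i] d₀)) = 1 := fun i hi ↦
    huA ⟨i, by omega, by omega, rfl⟩
  have huC' : ∀ i, n 0 + n 1 ≤ i → i < n 0 + n 1 + n 2 → u (.inr ((succ E)^[i] d₀)) = 0 :=
    fun i h1 h2 ↦ huC ⟨i, by omega, by omega, rfl⟩
  -- its energy is the current `I` out of `A`, and `𝒞(A ↔ C) = I > 0`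
  have hIcur := hR.dirE_eq_current hlap hB hD huA' huC'
  have hC02 : effectiveConductance (extGraph E) 1 (extArc E d₀ n 0) (extArc E d₀ n 2) =
      ENNReal.ofReal (dirE E d₀ n u) :=
    le_antisymm ((effectiveConductance_le_networkEnergy huA huC).trans_eq (hR.networkEnergy_eq_dirE u))
      (le_effectiveConductance fun v hvA hvC ↦ by
        rw [hR.networkEnergy_eq_dirE]; exact ENNReal.ofReal_le_ofReal (hmin v hvA hvC))
  have hIpos : 0 < dirE E d₀ n u := by
    by_contra hle
    have h := hR.le_effectiveConductance_mul
    rw [hC02, ENNReal.ofReal_of_nonpos (not_lt.1 hle), zero_mul, nonpos_iff_eq_zero,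
      ENNReal.ofReal_eq_zero] at h
    norm_num at h
  -- the harmonic conjugate and the test function for `(B_ext, D_ext)`
  obtain ⟨κ, hκ, hκ0⟩ := hR.exists_conjugate hlap
  have hEw := hR.dirE_wfun_le hκ hκ0 hlap
  have hwB : (extArc E d₀ n 1).EqOn (fun v ↦ (-(dirE E d₀ n u)⁻¹) * hR.wfun κ u v) 1 := by
    rintro _ ⟨i, h1, h2, rfl⟩
    show (-(dirE E d₀ n u)⁻¹) * psi E d₀ u (hR.idx ((succ E)^[i] d₀)) = 1
    have hS : ∑ l ∈ range (n 0), dP u ((succ E)^[l] d₀) = -dirE E d₀ n u := by linarith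
    rw [hR.idx_iterate (by omega), psi_eq_of_B hB (by omega) (by omega), hS]
    field_simp
  have hwD : (extArc E d₀ n 3).EqOn (fun v ↦ (-(dirE E d₀ n u)⁻¹) * hR.wfun κ u v) 0 := by
    rintro _ ⟨i, h1, h2, rfl⟩
    show (-(dirE E d₀ n u)⁻¹) * psi E d₀ u (hR.idx ((succ E)^[i] d₀)) = 0
    rw [hR.idx_iterate (by omega), hR.psi_eq_zero_of_D hlap hD (by omega) (by omega), mul_zero]
  have hC13 : effectiveConductance (extGraph E) 1 (extArc E d₀ n 1) (extArc E d₀ n 3) ≤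
      ENNReal.ofReal (96 / dirE E d₀ n u) := by
    refine (effectiveConductance_le_networkEnergy hwB hwD).trans ?_
    rw [hR.networkEnergy_eq_dirE, dirE_const_mul]
    refine ENNReal.ofReal_le_ofReal ?_
    calc (-(dirE E d₀ n u)⁻¹) ^ 2 * dirE E d₀ n (hR.wfun κ u)
        ≤ (-(dirE E d₀ n u)⁻¹) ^ 2 * (96 * dirE E d₀ n u) :=
          mul_le_mul_of_nonneg_left hEw (sq_nonneg _)
      _ = 96 / dirE E d₀ n u := by
          rw [neg_sq, inv_pow, inv_mul_eq_div, pow_two, mul_div_mul_right _ _ hIpos.ne']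
  -- conclusion
  unfold extResistance effectiveResistance
  rw [hC02]
  have h96 : ENNReal.ofReal (1 / 96) =
      (ENNReal.ofReal (dirE E d₀ n u))⁻¹ * (ENNReal.ofReal (96 / dirE E d₀ n u))⁻¹ := by
    rw [← ENNReal.mul_inv (Or.inr ENNReal.ofReal_ne_top) (Or.inl ENNReal.ofReal_ne_top),
      ← ENNReal.ofReal_mul hIpos.le, ← mul_div_assoc, mul_div_cancel_left₀ _ hIpos.ne',
      ← ENNReal.ofReal_inv_of_pos (by norm_num : (0 : ℝ) < 96), one_div]
  rw [h96]
  exact mul_le_mul' le_rfl (ENNReal.inv_le_inv.2 hC13)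

end LowerBound



















end DiscreteRect

/-- **Self-duality of discrete extremal lengths** (Chelkak–Duminil-Copin–Hongler 2016, §3.3, third
displayed property): there is an absolute constant `C ≥ 1` (here `C = 5476`) with
`C⁻¹ ≤ ℓ_Ω̄[(a_ext b_ext),(c_ext d_ext)] · ℓ_Ω̄[(b_ext c_ext),(d_ext a_ext)] ≤ C` for every discrete
topological rectangle — discharge of the named fact `discreteEL_ext_selfDual` from
`IsRect.le_extResistance_mul_extResistance` (lower half, `≥ 1/96`) and
`IsRect.extResistance_mul_extResistance_le` (upper half, `≤ 5476`).
[cite: ChelkakDuminilCopinHongler2016, §3.3 (self-duality of discrete extremal lengths)] -/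
theorem discreteEL_ext_selfDual_holds : discreteEL_ext_selfDual := by
  refine ⟨5476, by norm_num, fun E d₀ n hR ↦ ⟨?_, hR.extResistance_mul_extResistance_le⟩⟩
  calc ENNReal.ofReal (5476 : ℝ)⁻¹ ≤ ENNReal.ofReal (1 / 96) := ENNReal.ofReal_le_ofReal (by norm_num)
    _ ≤ _ := hR.le_extResistance_mul_extResistance

end Literature.Probability.LatticeModels

end
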